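import Literature.NumberTheory.QuadraticFields.QuadraticOrdersInvertibleLattices
import Mathlib.NumberTheory.NumberField.Basic
import Mathlib.RingTheory.IntegralClosure.IntegrallyClosed
import Mathlib.Algebra.Module.Projective
import Mathlib.LinearAlgebra.FreeModule.PID
import Mathlib.LinearAlgebra.Dimension.Finrank
import Mathlib.GroupTheory.Archimedean
import Mathlib.RingTheory.Int.Basic
import HarnessLib

/-!
# Lattices over a quadratic order are direct sums of rank-one lattices
# (Borevich–Faddeev 1960; Jordan–Keeton–Poonen–Rains–Shepherd-Barron–Tate 2018, Thm. 3.2 (1): existence)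

Topic `Literature/NumberTheory/QuadraticFields`, namespace
`Literature.NumberTheory.QuadraticFields.QuadraticOrderLattice`.  Family `hodge`, lane `lit-hodgefound`
(Track 2 foundations library), seat p18 gen 11, row g11-#1, FILE 1 (pure algebra); FILE 2
(`Geometry/Kaehler/ComplexTorusProductOfEllipticCurvesAnyOrder`) applies it to period lattices: a complex
torus isogenous to `E^g` with `E` a CM elliptic curve is ISOMORPHIC to a product of elliptic curves
(Lange 2023 §5.1.5 Exercise (15) in full; Hulek–Laface 2019 Thm. 4.1 (2) ⟹ (3)).  This is the
NON-maximal-order counterpart of `RingTheory/DedekindDomain/LatticePseudoBasis` (O'Meara Thm. 81:3,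
pseudo-bases over a Dedekind domain, row Q804) and consumes, by name, Cox's Prop. 7.4 for an arbitrary
order (`QuadraticOrdersInvertibleLattices`: every rank-two lattice of a quadratic field is invertible for
its own order).  THEOREMS ONLY — no definition, no named fact (D-0026; net Literature debt 0).

## Source, VERBATIM

B. W. Jordan, A. G. Keeton, B. Poonen, E. M. Rains, N. Shepherd-Barron, J. T. Tate, *Abelian varieties
isogenous to a power of an elliptic curve*, Compositio Math. 154 (2018) 934–959
[JKPRST2018IsogenousPowerElliptic] (held text `paper:arxiv-1602.06237`, p. 6), §3.2:

> For a general order in a Dedekind domain, the structure theory of torsion-free f.p. modules is wild.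
> Fortunately, for quadratic orders there is a theory that is only slightly more complicated than that
> for Dedekind domains. […] **Theorem 3.2.** Let `R` be a quadratic order, i.e., an order in a degree
> `2` extension `K` of `ℚ`. Let `M` be a f.p. torsion-free `R`-module. • There exists a unique chain of
> orders `R₁ ⊆ ⋯ ⊆ Rₙ` between `R` and `K` and invertible ideals `I₁, …, Iₙ` of `R₁, …, Rₙ`,
> respectively, such that `M ≅ I₁ ⊕ ⋯ ⊕ Iₙ` as an `R`-module. • The `Iᵢ` are not unique, but their
> product `I₁⋯Iₙ` is an invertible `Rₙ`-ideal whose class `[M] ∈ Pic Rₙ` depends only on `M`. • The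
> isomorphism type of `M` is uniquely determined by the chain `R₁ ⊆ ⋯ ⊆ Rₙ` and the class
> `[M] ∈ Pic Rₙ`. *Proof.* See [Borevich–Faddeev 1960]. For generalizations to other integral domains,
> see [Bass 1963], [Borevich–Faddeev 1965], [Levy 1985], and the survey article [Salce 2002].

(Z. I. Borevich, D. K. Faddeev, *Integral representations of quadratic rings*, Vestnik Leningrad.
Univ. 15 (1960); H. Bass, *On the ubiquity of Gorenstein rings*, Math. Z. 82 (1963) §7.  Neither is
held; the proof below is NOT the printed one — DECLARED DEVIATION — but an elementary argument through
the Gorenstein (trace-dual) pairing of `ℤ[θ]` written for this file.)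

## What is formalised (any field `K` with `[K : ℚ] = 2`, any `K`-vector space `V`)

A *lattice* is a finitely generated `ℤ`-submodule `L : Submodule ℤ V`; "`L` is a module over some order
of `K`" is the hypothesis `θ₀ • L ⊆ L` for ONE irrational `θ₀ ∈ K` (`∀ q : ℚ, (q : K) ≠ θ₀`).  The
*multiplier order* `R(L) = {x ∈ K : xL ⊆ L}` and the *coefficient lattice* `I_m = {x ∈ K : xm ∈ L}`
of a vector are written as explicit predicates / characterised `ℤ`-submodules of `K` (no new
definition); orders of `K` are `Submodule.span ℤ {1, θ}` and Cox's `(𝔪 : 𝔪)` is Mathlib's submodule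
quotient `𝔪 / 𝔪`, as in `QuadraticOrdersInvertibleLattices`.

* §1 **rank two** (`exists_eq_span_ratCast_pair`, `exists_eq_span_one_pair`): a lattice of `K`
  containing `1` and an irrational is `ℤr + ℤy` (`r ∈ ℚˣ`, `(r, y)` `ℚ`-independent); an order is
  `ℤ + ℤθ` (its rational elements are integers — integrality).  [Cox §7.A.]
* §2 **the multiplier order of a lattice `L ⊆ V` is a quadratic order** `R(L) = ℤ + ℤθ`, `θ² = tθ + n`
  (`multiplier_eq_span_one_pair`).
* §3 **a GOOD vector** (`exists_good_vector`): some `m ∈ L ∖ 0` has `R(I_m) ⊆ R(L)` (hence `=`) — the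
  substitute for the first summand `I₁`, `R(I₁) = R(M)`, of the Borevich–Faddeev normal form.  Proof:
  with `O = R(L)`, `D > 0` a uniform denominator of `𝓞_K` over `O` (`𝓞_K` is finitely generated), call
  `m` *bad at `p`* if `ym ∈ L` for some integral `y ∉ O` with `py ∈ O`; such `y` form ONE class
  `ℤyₚ + O` (`1/p ∉ 𝓞_K`), badness is invariant under `m ↦ m + pL`, and not every vector is bad
  (else `yₚ ∈ R(L) = O`); a Chinese-remainder induction over the primes `p ∣ D` gives `m` bad at none,
  and for such `m` every `x ∈ R(I_m) ∖ O` would produce a witness `(e/p)x` (`e` least with `ex ∈ O`).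
* §4 **the splitting** (`exists_splitting`): for a good `m`, `J = I_m = ℤα + ℤβ` is invertible,
  `JJ′ = O` (Cox Prop. 7.4, by name), `W = J′L ≤ L` is `O`-stable with `W ∩ Km = Om` SATURATED; the
  Smith normal form of `Om ≤ W` (Mathlib) gives a `ℤ`-linear `g : W → ℤ`, `g(m) = 0`, `g(θm) = 1`;
  the Gorenstein pairing `λ(a + bθ) = b` of `ℤ[θ]` turns it into the `O`-LINEAR
  `φ(w) = (g(θw) − t g(w)) + g(w)θ`, `φ(m) = 1`; `ψ = d⁻¹φ(d ·) : L → J` (`d ∈ J′ ∩ ℤ ∖ 0`) has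
  `ψ(xm) = x`, and **`L = Jm ⊕ L₂`**, `L₂ = L ∩ ker ψ` `θ`-stable, `m ∉ KL₂`.
* §5 **THEOREM** `exists_rankOne_decomposition` (induction on `dim_K KL`):
  **`v ∈ L ↔ ∃ c : Fin n → K, (∀ i, c i ∈ ℤαᵢ + ℤβᵢ) ∧ v = Σ cᵢ • yᵢ`** with `y` `K`-linearly
  independent in `L`, `span K (range y) = span K L`, `n = dim_K KL`, every `(αᵢ, βᵢ)` `ℚ`-independent
  (so each `Iᵢ = ℤαᵢ + ℤβᵢ ∋ 1` is a rank-two lattice, invertible for its own order by Cox 7.4);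
  `smul_mem_iff_of_decomposition` (the coefficient of `yᵢ` is `Iᵢ`, O'Meara 81:4).

NOT here (`-- TODO(general form)`): the chain condition `R(I₁) ⊆ ⋯ ⊆ R(Iₙ)`, the invariant
`[I₁⋯Iₙ] ∈ Pic Rₙ` and the uniqueness (Thm. 3.2 (1)–(3) in full); Bass orders beyond the quadratic
case; the torus consequences (FILE 2).

## References
* [JKPRST2018IsogenousPowerElliptic] Jordan–Keeton–Poonen–Rains–Shepherd-Barron–Tate, Compositio
  Math. 154 (2018), §3.2 Thm. 3.2, p. 6 (= arXiv:1602.06237).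
* [Cox2013] D. A. Cox, *Primes of the form x² + ny²*, 2nd ed., §7.A Prop. 7.4, Lemma 7.5, pp. 133–136.
* [Omeara1963] O. T. O'Meara, *Introduction to Quadratic Forms*, §81B 81:3–81:4, pp. 211–212.
* Z. I. Borevich, D. K. Faddeev, Vestnik Leningrad. Univ. 15 (1960) no. 19, 125–130 (not held).
* H. Bass, On the ubiquity of Gorenstein rings, Math. Z. 82 (1963) 8–28, §7 (not held).
-/

noncomputable section

open Module Submodule
open scoped Pointwise

namespace Literature.NumberTheory.QuadraticFields

namespace QuadraticOrderLattice

/-! ## §0. Bookkeeping: finitely generated `ℤ`-submodules, rational coordinates, integrality -/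

section Bookkeeping

variable {K : Type*} [Field K] [CharZero K]

/-- A `ℤ`-submodule of a finitely generated `ℤ`-module is finitely generated (`ℤ` is Noetherian).
[folklore] -/
private theorem fg_of_le {M : Type*} [AddCommGroup M] {N L : Submodule ℤ M} (hNL : N ≤ L) (hL : L.FG) :
    N.FG := by
  haveI : IsNoetherian ℤ L := isNoetherian_of_fg_of_noetherian _ hL
  have h : (N.comap L.subtype).FG := IsNoetherian.noetherian _
  have hmap : (N.comap L.subtype).map L.subtype = N := by
    rw [Submodule.map_comap_subtype, inf_eq_right.2 hNL]
  rw [← hmap]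
  exact h.map _

/-- In a quadratic field every element is `u + vθ` with `u, v ∈ ℚ`, for any `θ ∉ ℚ`.
[cite: Cox2013, §7.A Lemma 7.5 («`K = ℚ(τ)`»), p. 135] -/
theorem exists_rat_add_rat_mul (h2 : finrank ℚ K = 2) {θ : K} (hθ : ∀ q : ℚ, (q : K) ≠ θ) (x : K) :
    ∃ u v : ℚ, x = u + v * θ := by
  haveI : Module.Finite ℚ K := Module.finite_of_finrank_pos (by rw [h2]; norm_num)
  have hdep : ¬ LinearIndependent ℚ ![(1 : K), θ, x] := fun h => by
    have h3 := h.fintype_card_le_finrank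
    rw [Fintype.card_fin, h2] at h3
    omega
  obtain ⟨g, hg, i, hi⟩ := Fintype.not_linearIndependent_iff.1 hdep
  simp only [Fin.sum_univ_three, Matrix.cons_val_zero, Matrix.cons_val_one, Matrix.cons_val_two,
    Matrix.head_cons, Matrix.tail_cons, Rat.smul_def, mul_one] at hg
  have hg2 : g 2 ≠ 0 := by
    intro h0
    rw [h0, Rat.cast_zero, zero_mul, add_zero] at hg
    by_cases h1 : g 1 = 0
    · rw [h1, Rat.cast_zero, zero_mul, add_zero] at hg
      have h00 : g 0 = 0 := by exact_mod_cast hg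
      fin_cases i <;> simp_all
    · apply hθ (-g 0 / g 1)
      have h1' : ((g 1 : ℚ) : K) ≠ 0 := by exact_mod_cast h1
      have e : θ = -((g 0 : ℚ) : K) / ((g 1 : ℚ) : K) := by
        rw [eq_div_iff h1']
        linear_combination hg
      rw [e]
      push_cast
      ring
  refine ⟨-g 0 / g 2, -g 1 / g 2, ?_⟩
  have h2' : ((g 2 : ℚ) : K) ≠ 0 := by exact_mod_cast hg2
  push_cast
  field_simp
  linear_combination hg

/-- The coefficients `u, v` of `x = u + vθ` are unique (`1, θ` are `ℚ`-independent).
[cite: Cox2013, §7.A Lemma 7.5, p. 135] -/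
theorem rat_add_rat_mul_inj {θ : K} (hθ : ∀ q : ℚ, (q : K) ≠ θ) {u v u' v' : ℚ}
    (h : (u : K) + v * θ = u' + v' * θ) : u = u' ∧ v = v' :=
  QuadraticLattice.ratCast_add_ratCast_mul_inj hθ h

/-- A rational number that is integral over `ℤ` (inside `K`) is an integer. [folklore] -/
private theorem exists_int_of_isIntegral_ratCast {q : ℚ} (h : IsIntegral ℤ ((q : ℚ) : K)) :
    ∃ z : ℤ, (z : ℚ) = q := by
  have h1 : IsIntegral ℤ q := by
    have e : (algebraMap ℚ K q) = (q : K) := rfl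
    rw [← e] at h
    exact (isIntegral_algebraMap_iff (algebraMap ℚ K).injective).1 h
  obtain ⟨z, hz⟩ := (IsIntegrallyClosed.isIntegral_iff (R := ℤ) (K := ℚ)).1 h1
  exact ⟨z, by simpa using hz⟩

/-- **A common denominator**: a finitely generated `ℤ`-submodule `S` of a quadratic field lies in
`D⁻¹(ℤ + ℤθ)` for some integer `D > 0`. [folklore] -/
private theorem exists_nat_mul_mem_span_one_pair (h2 : finrank ℚ K = 2) {θ : K} (hθ : ∀ q : ℚ, (q : K) ≠ θ)
    {S : Submodule ℤ K} (hS : S.FG) :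
    ∃ D : ℕ, 0 < D ∧ ∀ x ∈ S, ((D : ℕ) : K) * x ∈ Submodule.span ℤ ({1, θ} : Set K) := by
  classical
  obtain ⟨s, hs⟩ := hS
  -- each generator is `u + vθ`; take the product of all denominators
  have hgen : ∀ x : K, ∃ d : ℕ, 0 < d ∧ ((d : ℕ) : K) * x ∈ Submodule.span ℤ ({1, θ} : Set K) := by
    intro x
    obtain ⟨u, v, rfl⟩ := exists_rat_add_rat_mul h2 hθ x
    refine ⟨u.den * v.den, Nat.mul_pos u.den_pos v.den_pos, ?_⟩
    rw [QuadraticLattice.mem_span_one_pair_iff]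
    refine ⟨u.num * v.den, v.num * u.den, ?_⟩
    have hu : (u : K) * (u.den : K) = (u.num : K) := by exact_mod_cast Rat.mul_den_eq_num u
    have hv : (v : K) * (v.den : K) = (v.num : K) := by exact_mod_cast Rat.mul_den_eq_num v
    push_cast
    linear_combination (v.den : K) * hu + ((u.den : K) * θ) * hv
  choose d hdpos hd using hgen
  refine ⟨∏ x ∈ s, d x, Finset.prod_pos fun x _ => hdpos x, fun x hx => ?_⟩
  rw [← hs] at hx
  induction hx using Submodule.span_induction with
  | mem y hy =>
    obtain ⟨e, he⟩ : d y ∣ ∏ x ∈ s, d x := Finset.dvd_prod_of_mem d hy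
    rw [he, Nat.cast_mul, mul_comm ((d y : ℕ) : K), mul_assoc]
    have e1 : ((e : ℕ) : K) * (((d y : ℕ) : K) * y) = (e : ℤ) • (((d y : ℕ) : K) * y) := by
      rw [zsmul_eq_mul, Int.cast_natCast]
    rw [e1]
    exact Submodule.smul_mem _ _ (hd y)
  | zero => rw [mul_zero]; exact Submodule.zero_mem _
  | add y z _ _ hy hz => rw [mul_add]; exact Submodule.add_mem _ hy hz
  | smul n y _ hy => rw [mul_smul_comm]; exact Submodule.smul_mem _ _ hy

end Bookkeeping

/-! ## §1. Lattices of rank two in a quadratic field: `L = ℤr + ℤy`; orders are `ℤ + ℤθ` -/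

section RankTwo

variable {K : Type*} [Field K] [CharZero K]

/-- **A finitely generated subgroup of `ℚ` is cyclic.** [folklore] -/
private theorem exists_eq_span_singleton_of_fg {H : Submodule ℤ ℚ} (hH : H.FG) :
    ∃ r : ℚ, H = Submodule.span ℤ {r} := by
  classical
  obtain ⟨s, hs⟩ := hH
  -- a common denominator `D` of the generators
  set D : ℕ := ∏ q ∈ s, q.den with hD
  have hDpos : 0 < D := Finset.prod_pos fun q _ => q.den_pos
  have hD0 : (D : ℚ) ≠ 0 := by exact_mod_cast hDpos.ne'
  have hint : ∀ h ∈ H, ∃ z : ℤ, (z : ℚ) = D * h := by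
    intro h hh
    rw [← hs] at hh
    induction hh using Submodule.span_induction with
    | mem q hq =>
      obtain ⟨e, he⟩ : q.den ∣ D := Finset.dvd_prod_of_mem _ hq
      refine ⟨e * q.num, ?_⟩
      rw [he]
      push_cast
      rw [mul_comm (q.den : ℚ) (e : ℚ), mul_assoc, Rat.den_mul_eq_num]
    | zero => exact ⟨0, by simp⟩
    | add x y _ _ hx hy =>
      obtain ⟨a, ha⟩ := hx
      obtain ⟨b, hb⟩ := hy
      exact ⟨a + b, by push_cast; rw [ha, hb, mul_add]⟩
    | smul n x _ hx =>
      obtain ⟨a, ha⟩ := hx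
      exact ⟨n * a, by push_cast; rw [ha, zsmul_eq_mul, mul_left_comm]⟩
  -- the numerators form a subgroup of `ℤ`, which is cyclic
  let G : AddSubgroup ℤ :=
    { carrier := {z : ℤ | (z : ℚ) / D ∈ H}
      zero_mem' := by simp
      add_mem' := fun {a b} ha hb => by
        simp only [Set.mem_setOf_eq, Int.cast_add, add_div] at ha hb ⊢
        exact H.add_mem ha hb
      neg_mem' := fun {a} ha => by
        simp only [Set.mem_setOf_eq, Int.cast_neg, neg_div] at ha ⊢
        exact H.neg_mem ha }
  obtain ⟨a, ha⟩ := Int.subgroup_cyclic G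
  refine ⟨(a : ℚ) / D, le_antisymm ?_ ?_⟩
  · intro h hh
    obtain ⟨z, hz⟩ := hint h hh
    have hzG : z ∈ G := by
      change (z : ℚ) / D ∈ H
      rw [hz, mul_div_cancel_left₀ _ hD0]
      exact hh
    rw [ha, AddSubgroup.mem_closure_singleton] at hzG
    obtain ⟨k, hk⟩ := hzG
    rw [Submodule.mem_span_singleton]
    refine ⟨k, ?_⟩
    have e : h = (z : ℚ) / D := by rw [hz, mul_div_cancel_left₀ _ hD0]
    have hz' : (z : ℚ) = (k : ℚ) * a := by rw [← hk, smul_eq_mul, Int.cast_mul]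
    rw [zsmul_eq_mul, e, hz', mul_div_assoc]
  · rw [Submodule.span_le, Set.singleton_subset_iff]
    have haG : a ∈ G := by rw [ha]; exact AddSubgroup.subset_closure rfl
    exact haG

/-- **The `θ`-coordinate.** For `θ ∉ ℚ` in a quadratic field there is a `ℤ`-linear `f : K → ℚ` with
`x = u + f(x)·θ` for some rational `u`, for every `x`; in particular `f(u + vθ) = v`. [folklore] -/
private theorem exists_coord (h2 : finrank ℚ K = 2) {θ : K} (hθ : ∀ q : ℚ, (q : K) ≠ θ) :
    ∃ f : K →ₗ[ℤ] ℚ, (∀ u v : ℚ, f (u + v * θ) = v) ∧ ∀ x : K, ∃ u : ℚ, x = u + (f x : ℚ) * θ := by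
  choose u v huv using exists_rat_add_rat_mul h2 hθ
  have hv : ∀ (a b : ℚ), v (a + b * θ) = b := fun a b =>
    (rat_add_rat_mul_inj hθ (huv (a + b * θ)).symm).2
  have hu : ∀ (a b : ℚ), u (a + b * θ) = a := fun a b =>
    (rat_add_rat_mul_inj hθ (huv (a + b * θ)).symm).1
  refine ⟨{ toFun := v, map_add' := fun x y => ?_, map_smul' := fun n x => ?_ },
    fun a b => hv a b, fun x => ⟨u x, huv x⟩⟩
  · have e : x + y = ((u x + u y : ℚ) : K) + ((v x + v y : ℚ) : K) * θ := by
      conv_lhs => rw [huv x, huv y]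
      push_cast; ring
    rw [e, hv]
  · have e : n • x = ((n * u x : ℚ) : K) + ((n * v x : ℚ) : K) * θ := by
      conv_lhs => rw [huv x]
      rw [zsmul_eq_mul]; push_cast; ring
    rw [e, hv, RingHom.id_apply, zsmul_eq_mul]

/-- **Every lattice of a quadratic field containing `1` and an irrational `θ₀` is `ℤr + ℤy`** with
`r ∈ ℚˣ` and `(r, y)` `ℚ`-independent (so `y ∉ ℚ`): project onto the `θ₀`-coordinate — the image and the
rational part are finitely generated subgroups of `ℚ`, hence cyclic.
[cite: Cox2013, §7.A proof of Prop. 7.4 («`𝔞` is a `ℤ`-module of rank 2, so that `𝔞 = [α, β]`»), p. 135] -/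
theorem exists_eq_span_ratCast_pair (h2 : finrank ℚ K = 2) {θ₀ : K} (hθ₀ : ∀ q : ℚ, (q : K) ≠ θ₀)
    {L : Submodule ℤ K} (hL : L.FG) (h1 : (1 : K) ∈ L) (hθL : θ₀ ∈ L) :
    ∃ (r : ℚ) (y : K), r ≠ 0 ∧ (∀ q : ℚ, (q : K) ∈ L ↔ ∃ k : ℤ, q = k * r) ∧
      L = Submodule.span ℤ ({(r : K), y} : Set K) ∧ LinearIndependent ℚ ![(r : K), y] := by
  classical
  obtain ⟨f, hf, hfx⟩ := exists_coord h2 hθ₀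
  -- the image `f(L) ⊆ ℚ` is cyclic, generated by `f y`, `y ∈ L`
  obtain ⟨r₂, hr₂⟩ := exists_eq_span_singleton_of_fg (hL.map f)
  have hyex : ∃ y ∈ L, f y = r₂ := by
    have : r₂ ∈ L.map f := by rw [hr₂]; exact Submodule.mem_span_singleton_self _
    obtain ⟨y, hy, hfy⟩ := Submodule.mem_map.1 this
    exact ⟨y, hy, hfy⟩
  obtain ⟨y, hyL, hfy⟩ := hyex
  -- the rational part `{q : (q : K) ∈ L}` is cyclic, generated by `r`
  let ι : ℚ →ₗ[ℤ] K :=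
    { toFun := fun q => (q : K),
      map_add' := fun a b => by push_cast; rfl,
      map_smul' := fun n a => by rw [zsmul_eq_mul, zsmul_eq_mul]; push_cast; rfl }
  have hιinj : Function.Injective ι := fun a b h => Rat.cast_injective (α := K) h
  have hGfg : (L.comap ι).FG := by
    refine Submodule.fg_of_fg_map_injective ι hιinj (fg_of_le ?_ hL)
    exact Submodule.map_comap_le _ _
  obtain ⟨r, hr⟩ := exists_eq_span_singleton_of_fg hGfg
  have hGmem : ∀ q : ℚ, (q : K) ∈ L ↔ ∃ k : ℤ, q = k * r := by
    intro q
    have : (q : K) ∈ L ↔ q ∈ L.comap ι := Iff.rfl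
    rw [this, hr, Submodule.mem_span_singleton]
    constructor
    · rintro ⟨k, hk⟩; exact ⟨k, by rw [← hk, zsmul_eq_mul]⟩
    · rintro ⟨k, hk⟩; exact ⟨k, by rw [hk, zsmul_eq_mul]⟩
  have hr0 : r ≠ 0 := by
    intro h0
    obtain ⟨k, hk⟩ := (hGmem 1).1 (by exact_mod_cast h1)
    rw [h0, mul_zero] at hk
    exact one_ne_zero hk
  have hr₂0 : r₂ ≠ 0 := by
    intro h0
    have hθim : f θ₀ ∈ L.map f := Submodule.mem_map_of_mem hθL
    rw [hr₂, h0, Submodule.mem_span_singleton] at hθim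
    obtain ⟨k, hk⟩ := hθim
    have h01 : f θ₀ = 1 := by
      have := hf 0 1
      simp only [Rat.cast_zero, Rat.cast_one, one_mul, zero_add] at this
      exact this
    rw [smul_zero, h01] at hk
    exact zero_ne_one hk
  have hrL : (r : K) ∈ L := (hGmem r).2 ⟨1, by simp⟩
  refine ⟨r, y, hr0, hGmem, le_antisymm ?_ ?_, ?_⟩
  · -- `L ⊆ ℤr + ℤy`: subtract the right multiple of `y`, the rest is rational
    intro x hx
    have hfxim : f x ∈ L.map f := Submodule.mem_map_of_mem hx
    rw [hr₂, Submodule.mem_span_singleton] at hfxim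
    obtain ⟨k, hk⟩ := hfxim
    have hz : f (x - k • y) = 0 := by rw [map_sub, map_zsmul, hfy, hk, sub_self]
    obtain ⟨u, hu⟩ := hfx (x - k • y)
    rw [hz, Rat.cast_zero, zero_mul, add_zero] at hu
    have huL : (u : K) ∈ L := by rw [← hu]; exact L.sub_mem hx (L.smul_mem k hyL)
    obtain ⟨j, hj⟩ := (hGmem u).1 huL
    rw [QuadraticLattice.mem_span_pair_iff_exists_int]
    refine ⟨j, k, ?_⟩
    have e : x = (u : K) + k • y := by rw [← hu, sub_add_cancel]
    rw [e, hj, zsmul_eq_mul]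
    push_cast
    ring
  · rw [Submodule.span_le]
    intro z hz
    rcases hz with rfl | hz
    · exact hrL
    · rw [Set.mem_singleton_iff] at hz; rw [hz]; exact hyL
  · -- independence: apply `f` (`f r = 0`, `f y = r₂ ≠ 0`)
    rw [LinearIndependent.pair_iff]
    intro a b hab
    have hfr : f (r : K) = 0 := by
      have := hf r 0
      simp only [Rat.cast_zero, zero_mul, add_zero] at this
      exact this
    have hfab : (a * 0 + b * r₂ : ℚ) = 0 := by
      have e : a • (r : K) + b • y = ((a * r : ℚ) : K) + ((b.num : ℤ) • y) * ((b.den : ℕ) : K)⁻¹ := by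
        rw [Rat.smul_def, Rat.smul_def]
        push_cast
        rw [zsmul_eq_mul]
        have hb : (b : K) = (b.num : K) / (b.den : K) := by exact_mod_cast (Rat.num_div_den b).symm
        rw [hb]
        field_simp
      -- cleaner: use `f`'s additivity on rational multiples via `hf`
      have key : ∀ (c : ℚ) (w : K), f ((c : K) * w) = c * f w := by
        intro c w
        obtain ⟨u, hu⟩ := hfx w
        have ew : (c : K) * w = ((c * u : ℚ) : K) + ((c * f w : ℚ) : K) * θ₀ := by
          conv_lhs => rw [hu]
          push_cast; ring
        rw [ew, hf]
      have h := congrArg f hab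
      rw [map_zero, map_add, Rat.smul_def, Rat.smul_def, key, key, hfr, hfy] at h
      exact h
    rw [mul_zero, zero_add] at hfab
    have hb : b = 0 := (mul_eq_zero.1 hfab).resolve_right hr₂0
    rw [hb, zero_smul, add_zero, Rat.smul_def, mul_eq_zero] at hab
    have ha : a = 0 := by
      rcases hab with h | h
      · exact_mod_cast h
      · exact absurd h (by exact_mod_cast hr0)
    exact ⟨ha, hb⟩

/-- **Every order of a quadratic field is `ℤ + ℤθ`**: a lattice `O ∋ 1, θ₀` whose rational elements are
integers is `span ℤ {1, θ}` with `θ ∉ ℚ`. [cite: Cox2013, §7.A («an order 𝒪 … is a free ℤ-module of rank 2»; Lemma 7.2), pp. 133–134] -/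
theorem exists_eq_span_one_pair (h2 : finrank ℚ K = 2) {θ₀ : K} (hθ₀ : ∀ q : ℚ, (q : K) ≠ θ₀)
    {O : Submodule ℤ K} (hO : O.FG) (h1 : (1 : K) ∈ O) (hθO : θ₀ ∈ O)
    (hint : ∀ q : ℚ, (q : K) ∈ O → ∃ z : ℤ, (z : ℚ) = q) :
    ∃ θ : K, (∀ q : ℚ, (q : K) ≠ θ) ∧ O = Submodule.span ℤ ({1, θ} : Set K) := by
  obtain ⟨r, y, hr0, hrat, hOeq, hli⟩ := exists_eq_span_ratCast_pair h2 hθ₀ hO h1 hθO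
  -- `r ∈ O ∩ ℚ = ℤ` and `1 ∈ ℤr` force `r = ±1`
  have hrO : (r : K) ∈ O := (hrat r).2 ⟨1, by simp⟩
  obtain ⟨z, hz⟩ := hint r hrO
  obtain ⟨k, hk⟩ := (hrat 1).1 (by exact_mod_cast h1)
  have hzunit : z = 1 ∨ z = -1 := by
    rw [← hz] at hk
    have hk' : (1 : ℤ) = k * z := by exact_mod_cast hk
    rcases Int.eq_one_or_neg_one_of_mul_eq_one' hk'.symm with ⟨-, h⟩ | ⟨-, h⟩
    · exact Or.inl h
    · exact Or.inr h
  obtain ⟨hy0, hyq⟩ := QuadraticLattice.ratCast_ne_div_of_linearIndependent hli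
  refine ⟨y, fun q hq => ?_, ?_⟩
  · -- `y ∉ ℚ`: else `(r, y)` would be dependent
    apply hyq (q / r)
    push_cast
    rw [hq]
  · rw [hOeq]
    have hr1 : ((r : K) = 1) ∨ ((r : K) = -1) := by
      rcases hzunit with h | h
      · left; rw [← hz, h]; simp
      · right; rw [← hz, h]; simp
    rcases hr1 with h | h
    · rw [h]
    · rw [h, Submodule.span_insert, Submodule.span_insert, ← Set.neg_singleton, Submodule.span_neg]

end RankTwo

/-! ## §2. Lattices in a `K`-vector space: the multiplier order `R(L)` and the coefficients `I_m` -/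

section Multiplier

variable {K : Type*} [Field K] [CharZero K]
variable {V : Type*} [AddCommGroup V] [Module K V]

omit [CharZero K] in
/-- An integer acts on `V` through `K` as the integer itself: `(n : K) • v = n • v`. [folklore] -/
private theorem intCast_smul_eq (n : ℤ) (v : V) : ((n : ℤ) : K) • v = n • v := Int.cast_smul_eq_zsmul K n v

omit [CharZero K] in
/-- **`ℤ + ℤθ` acts on a `θ`-stable lattice**: if `θL ⊆ L` then `xL ⊆ L` for every `x ∈ ℤ + ℤθ`.
[folklore] -/
private theorem smul_mem_of_mem_span_one_pair {θ : K} {L : Submodule ℤ V} (hθL : ∀ v ∈ L, θ • v ∈ L)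
    {x : K} (hx : x ∈ Submodule.span ℤ ({1, θ} : Set K)) {v : V} (hv : v ∈ L) : x • v ∈ L := by
  obtain ⟨a, b, rfl⟩ := QuadraticLattice.mem_span_one_pair_iff.1 hx
  rw [add_smul, mul_smul, intCast_smul_eq, intCast_smul_eq]
  exact L.add_mem (L.smul_mem a hv) (L.smul_mem b (hθL v hv))

omit [CharZero K] in
/-- **The coefficient lattice `I_m = {x ∈ K : xm ∈ L}`** of a vector `m` (O'Meara's "coefficient of `m`
in `L`") exists as a `ℤ`-submodule of `K`; it is finitely generated when `L` is and `m ≠ 0`, and it is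
stable under the multiplier order of `L`. [folklore] -/
private theorem exists_coeff (L : Submodule ℤ V) (m : V) :
    ∃ J : Submodule ℤ K, ∀ x : K, x ∈ J ↔ x • m ∈ L := by
  let f : K →ₗ[ℤ] V :=
    { toFun := fun x => x • m, map_add' := fun x y => add_smul x y m,
      map_smul' := fun n x => by rw [RingHom.id_apply, smul_assoc] }
  exact ⟨L.comap f, fun x => Iff.rfl⟩

omit [CharZero K] in
/-- `I_m` is finitely generated (for `m ≠ 0` it embeds into `L` by `x ↦ xm`). [folklore] -/
private theorem fg_coeff {L : Submodule ℤ V} (hL : L.FG) {m : V} (hm : m ≠ 0) {J : Submodule ℤ K}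
    (hJ : ∀ x : K, x ∈ J ↔ x • m ∈ L) : J.FG := by
  let f : K →ₗ[ℤ] V :=
    { toFun := fun x => x • m, map_add' := fun x y => add_smul x y m,
      map_smul' := fun n x => by rw [RingHom.id_apply, smul_assoc] }
  have hf : Function.Injective f := fun x y h => smul_left_injective K hm h
  refine Submodule.fg_of_fg_map_injective f hf (fg_of_le ?_ hL)
  rintro _ ⟨x, hx, rfl⟩
  exact (hJ x).1 hx

omit [CharZero K] in
/-- **The multiplier order `R(L) = {x ∈ K : xL ⊆ L}`** exists as a `ℤ`-submodule of `K`. [folklore] -/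
private theorem exists_multiplier (L : Submodule ℤ V) :
    ∃ O : Submodule ℤ K, ∀ x : K, x ∈ O ↔ ∀ v ∈ L, x • v ∈ L := by
  refine ⟨{ carrier := {x : K | ∀ v ∈ L, x • v ∈ L},
            zero_mem' := fun v _ => by rw [zero_smul]; exact L.zero_mem,
            add_mem' := fun {x y} hx hy v hv => by rw [add_smul]; exact L.add_mem (hx v hv) (hy v hv),
            smul_mem' := fun n x hx v hv => by rw [smul_assoc]; exact L.smul_mem n (hx v hv) },
    fun x => Iff.rfl⟩

omit [CharZero K] in
/-- Elements of the multiplier order are integral over `ℤ` (it is a ring and a finitely generated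
`ℤ`-module, as `R(L) ⊆ I_m` for any `m ∈ L ∖ 0`). [folklore] -/
private theorem isIntegral_of_mem_multiplier {L : Submodule ℤ V} (hL : L.FG) (hL0 : L ≠ ⊥)
    {O : Submodule ℤ K} (hO : ∀ x : K, x ∈ O ↔ ∀ v ∈ L, x • v ∈ L) {x : K} (hx : x ∈ O) :
    IsIntegral ℤ x := by
  obtain ⟨m, hmL, hm0⟩ := Submodule.exists_mem_ne_zero_of_ne_bot hL0
  obtain ⟨J, hJ⟩ := exists_coeff (K := K) L m
  let S : Subalgebra ℤ K :=
    { carrier := {x : K | ∀ v ∈ L, x • v ∈ L},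
      mul_mem' := fun {x y} hx hy v hv => by rw [mul_smul]; exact hx _ (hy v hv),
      one_mem' := fun v hv => by rw [one_smul]; exact hv,
      add_mem' := fun {x y} hx hy v hv => by rw [add_smul]; exact L.add_mem (hx v hv) (hy v hv),
      zero_mem' := fun v _ => by rw [zero_smul]; exact L.zero_mem,
      algebraMap_mem' := fun n v hv => by
        rw [algebraMap_int_eq, Int.coe_castRingHom, intCast_smul_eq]; exact L.smul_mem n hv }
  have hSO : Subalgebra.toSubmodule S ≤ J := fun y hy => (hJ y).2 (by
    have hy' : ∀ v ∈ L, y • v ∈ L := hy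
    exact hy' m hmL)
  have hSfg : (Subalgebra.toSubmodule S).FG := fg_of_le hSO (fg_coeff hL hm0 hJ)
  exact IsIntegral.of_mem_of_fg S hSfg x ((hO x).1 hx)

/-- **The multiplier order of a lattice is a quadratic order `ℤ + ℤθ`** (`θ ∉ ℚ`, `θ² = tθ + n`): for a
finitely generated, non-zero `L ⊆ V` stable under some irrational `θ₀` of the quadratic field `K`,
`{x ∈ K : xL ⊆ L} = ℤ + ℤθ`. [cite: Cox2013, §7.A (orders; Lemma 7.2), pp. 133–134] -/
theorem multiplier_eq_span_one_pair (h2 : finrank ℚ K = 2) {L : Submodule ℤ V} (hL : L.FG)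
    (hL0 : L ≠ ⊥) {θ₀ : K} (hθ₀ : ∀ q : ℚ, (q : K) ≠ θ₀) (hθ₀L : ∀ v ∈ L, θ₀ • v ∈ L)
    {O : Submodule ℤ K} (hO : ∀ x : K, x ∈ O ↔ ∀ v ∈ L, x • v ∈ L) :
    ∃ θ : K, (∀ q : ℚ, (q : K) ≠ θ) ∧ O = Submodule.span ℤ ({1, θ} : Set K) ∧
      ∃ t n : ℤ, θ * θ = t * θ + n := by
  obtain ⟨m, hmL, hm0⟩ := Submodule.exists_mem_ne_zero_of_ne_bot hL0
  obtain ⟨J, hJ⟩ := exists_coeff (K := K) L m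
  have hOJ : O ≤ J := fun y hy => (hJ y).2 ((hO y).1 hy m hmL)
  have hOfg : O.FG := fg_of_le hOJ (fg_coeff hL hm0 hJ)
  have h1 : (1 : K) ∈ O := (hO 1).2 fun v hv => by rw [one_smul]; exact hv
  have hθO : θ₀ ∈ O := (hO θ₀).2 hθ₀L
  have hint : ∀ q : ℚ, (q : K) ∈ O → ∃ z : ℤ, (z : ℚ) = q := fun q hq =>
    exists_int_of_isIntegral_ratCast (isIntegral_of_mem_multiplier hL hL0 hO hq)
  obtain ⟨θ, hθ, hOeq⟩ := exists_eq_span_one_pair h2 hθ₀ hOfg h1 hθO hint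
  refine ⟨θ, hθ, hOeq, ?_⟩
  have hθmem : θ ∈ O := by rw [hOeq]; exact QuadraticLattice.self_mem_span_one_pair θ
  have hθθ : θ * θ ∈ O := (hO _).2 fun v hv => by
    rw [mul_smul]; exact (hO θ).1 hθmem _ ((hO θ).1 hθmem v hv)
  rw [hOeq, QuadraticLattice.mem_span_one_pair_iff] at hθθ
  obtain ⟨n, t, hnt⟩ := hθθ
  exact ⟨t, n, by rw [hnt]; ring⟩

end Multiplier

/-! ## §3. A GOOD vector: `m ∈ L` whose coefficient lattice `I_m` has multiplier order exactly `R(L)` -/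

section GoodVector

variable {K : Type*} [Field K] [CharZero K]
variable {V : Type*} [AddCommGroup V] [Module K V]

/-- **A uniform denominator for the integers of `K` over `ℤ + ℤθ`**: there is `D > 0` with
`D·y ∈ ℤ + ℤθ` for every `y ∈ K` integral over `ℤ` (`𝓞_K` is a finitely generated `ℤ`-module).
[folklore] -/
private theorem exists_nat_mul_mem_of_isIntegral (h2 : finrank ℚ K = 2) {θ : K} (hθ : ∀ q : ℚ, (q : K) ≠ θ) :
    ∃ D : ℕ, 0 < D ∧ ∀ y : K, IsIntegral ℤ y → ((D : ℕ) : K) * y ∈ Submodule.span ℤ ({1, θ} : Set K) := by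
  haveI : FiniteDimensional ℚ K := Module.finite_of_finrank_pos (by rw [h2]; norm_num)
  haveI : NumberField K := NumberField.mk
  have hSfg : (Submodule.span ℤ (Set.range (NumberField.integralBasis K))).FG :=
    Submodule.fg_span (Set.finite_range _)
  obtain ⟨D, hD, hDS⟩ := exists_nat_mul_mem_span_one_pair h2 hθ hSfg
  refine ⟨D, hD, fun y hy => hDS y ?_⟩
  rw [NumberField.mem_span_integralBasis]
  exact ⟨⟨y, (mem_integralClosure_iff ℤ K).2 hy⟩, rfl⟩

/-- **The integral `y` with `py ∈ ℤ + ℤθ` form at most one class modulo `ℤ + ℤθ` (up to multiples)**: if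
`y, y'` are integral over `ℤ`, `py, py' ∈ O = ℤ + ℤθ` and `y ∉ O`, then `y' − cy ∈ O` for some `c ∈ ℤ`
(`1/p ∉ 𝓞_K`, so `p` cannot divide the `θ`-coefficient of `py`). [folklore] -/
private theorem exists_sub_int_mul_mem {θ : K} (hθint : IsIntegral ℤ θ) {p : ℕ}
    (hp : p.Prime) {y y' : K} (hy : IsIntegral ℤ y) (hy' : IsIntegral ℤ y')
    (hpy : (p : K) * y ∈ Submodule.span ℤ ({1, θ} : Set K))
    (hpy' : (p : K) * y' ∈ Submodule.span ℤ ({1, θ} : Set K))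
    (hyO : y ∉ Submodule.span ℤ ({1, θ} : Set K)) :
    ∃ c : ℤ, y' - c * y ∈ Submodule.span ℤ ({1, θ} : Set K) := by
  have hp0 : (p : K) ≠ 0 := by exact_mod_cast hp.ne_zero
  obtain ⟨u, v, huv⟩ := QuadraticLattice.mem_span_one_pair_iff.1 hpy
  obtain ⟨u', v', huv'⟩ := QuadraticLattice.mem_span_one_pair_iff.1 hpy'
  -- an integral element `(a + p k θ)/p` lies in `O`: `a/p = w - kθ` is integral, hence an integer
  have key : ∀ (w : K) (a k : ℤ), IsIntegral ℤ w → (p : K) * w = a + (p * k : ℤ) * θ →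
      w ∈ Submodule.span ℤ ({1, θ} : Set K) := by
    intro w a k hw hpw
    have hwk : w - k * θ = ((a / p : ℚ) : K) := by
      push_cast
      field_simp
      push_cast at hpw
      linear_combination hpw
    have hint : IsIntegral ℤ (w - k * θ) := hw.sub ((isIntegral_algebraMap (R := ℤ) (x := k)).mul hθint)
    rw [hwk] at hint
    obtain ⟨z, hz⟩ := exists_int_of_isIntegral_ratCast hint
    rw [QuadraticLattice.mem_span_one_pair_iff]
    refine ⟨z, k, ?_⟩
    have e : w = ((a / p : ℚ) : K) + k * θ := by rw [← hwk, sub_add_cancel]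
    rw [e, ← hz]
    push_cast
    ring
  -- `p ∤ v`
  have hv : ¬ (p : ℤ) ∣ v := by
    rintro ⟨k, hk⟩
    apply hyO
    exact key y u k hy (by rw [huv, hk])
  -- choose `c ≡ v'/v (mod p)` by Bézout: `βp + αv = 1`, `c = v'α`
  have hcop : IsCoprime (p : ℤ) v :=
    (Nat.prime_iff_prime_int.1 hp).irreducible.coprime_iff_not_dvd.2 hv
  obtain ⟨β, α, hβα⟩ := hcop
  set c : ℤ := v' * α with hc
  have hcv : (p : ℤ) ∣ (v' - c * v) := ⟨v' * β, by rw [hc]; linear_combination (-v') * hβα⟩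
  obtain ⟨k, hk⟩ := hcv
  refine ⟨c, key (y' - c * y) (u' - c * u) k (hy'.sub ((isIntegral_algebraMap (R := ℤ) (x := c)).mul hy)) ?_⟩
  have e : (p : K) * (y' - c * y) = (p : K) * y' - c * ((p : K) * y) := by ring
  rw [e, huv, huv']
  have hk' : ((v' : ℤ) : K) = c * v + p * k := by
    have : (v' : ℤ) = c * v + p * k := by linarith
    rw [this]; push_cast; ring
  push_cast
  rw [hk']
  ring

variable {L : Submodule ℤ V} {O : Submodule ℤ K}

omit [CharZero K] in
/-- **Translation by `pL` does not change badness at `p`** (same witness `y`: `y(m + pl) = ym + (py)l`).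
Here "`m` is bad at `p`" means: some integral `y ∉ O` with `py ∈ O` has `ym ∈ L`. [folklore] -/
private theorem bad_add_smul_iff (hO : ∀ x : K, x ∈ O ↔ ∀ v ∈ L, x • v ∈ L) {p : ℕ} {N : ℤ} (hpN : (p : ℤ) ∣ N)
    (m : V) {l : V} (hl : l ∈ L) :
    (∃ y : K, IsIntegral ℤ y ∧ (p : K) * y ∈ O ∧ y ∉ O ∧ y • (m + N • l) ∈ L) ↔
      (∃ y : K, IsIntegral ℤ y ∧ (p : K) * y ∈ O ∧ y ∉ O ∧ y • m ∈ L) := by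
  obtain ⟨M, rfl⟩ := hpN
  have key : ∀ y : K, (p : K) * y ∈ O → y • (((p : ℤ) * M) • l) ∈ L := by
    intro y hpy
    have e : y • (((p : ℤ) * M) • l) = ((p : K) * y) • (M • l) := by
      rw [mul_smul ((p : ℤ)) M l, ← intCast_smul_eq (K := K) (p : ℤ), smul_smul, Int.cast_natCast,
        mul_comm]
    rw [e]
    exact (hO _).1 hpy _ (L.smul_mem M hl)
  constructor
  · rintro ⟨y, hy, hpy, hyO, hym⟩
    refine ⟨y, hy, hpy, hyO, ?_⟩
    have e : y • m = y • (m + ((p : ℤ) * M) • l) - y • (((p : ℤ) * M) • l) := by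
      rw [smul_add, add_sub_cancel_right]
    rw [e]
    exact L.sub_mem hym (key y hpy)
  · rintro ⟨y, hy, hpy, hyO, hym⟩
    refine ⟨y, hy, hpy, hyO, ?_⟩
    rw [smul_add]
    exact L.add_mem hym (key y hpy)

/-- **Not every vector is bad at `p`**: if some integral `y₀ ∉ O` has `py₀ ∈ O = R(L) = ℤ + ℤθ`, some
`w ∈ L` has `yw ∉ L` for EVERY such `y` (else `y₀L ⊆ L`, i.e. `y₀ ∈ R(L) = O`). [folklore] -/
private theorem exists_not_bad (hO : ∀ x : K, x ∈ O ↔ ∀ v ∈ L, x • v ∈ L) {θ : K}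
    (hθint : IsIntegral ℤ θ) (hOeq : O = Submodule.span ℤ ({1, θ} : Set K)) {p : ℕ} (hp : p.Prime)
    {y₀ : K} (hy₀ : IsIntegral ℤ y₀) (hpy₀ : (p : K) * y₀ ∈ O) (hy₀O : y₀ ∉ O) :
    ∃ w ∈ L, ¬ ∃ y : K, IsIntegral ℤ y ∧ (p : K) * y ∈ O ∧ y ∉ O ∧ y • w ∈ L := by
  by_contra hall
  push Not at hall
  apply hy₀O
  rw [hO]
  intro w hw
  obtain ⟨y, hy, hpy, hyO, hyw⟩ := hall w hw
  rw [hOeq] at hpy hyO hpy₀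
  obtain ⟨c, hc⟩ := exists_sub_int_mul_mem hθint hp hy hy₀ hpy hpy₀ hyO
  have e : y₀ • w = (y₀ - c * y) • w + c • (y • w) := by
    rw [sub_smul, mul_smul, intCast_smul_eq, sub_add_cancel]
  rw [e]
  rw [← hOeq] at hc
  exact L.add_mem ((hO _).1 hc w hw) (L.smul_mem c hyw)

/-- **Avoiding finitely many primes at once** (Chinese-remainder style): for a finite set `S` of primes
there is a non-zero `m ∈ L` which is bad at no `p ∈ S`. [folklore] -/
private theorem exists_forall_not_bad (hL0 : L ≠ ⊥) (hO : ∀ x : K, x ∈ O ↔ ∀ v ∈ L, x • v ∈ L) {θ : K}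
    (hθint : IsIntegral ℤ θ) (hOeq : O = Submodule.span ℤ ({1, θ} : Set K))
    (S : Finset ℕ) (hS : ∀ p ∈ S, p.Prime) :
    ∃ m ∈ L, m ≠ 0 ∧ ∀ p ∈ S, ¬ ∃ y : K, IsIntegral ℤ y ∧ (p : K) * y ∈ O ∧ y ∉ O ∧ y • m ∈ L := by
  classical
  induction S using Finset.induction_on with
  | empty =>
    obtain ⟨m, hmL, hm0⟩ := Submodule.exists_mem_ne_zero_of_ne_bot hL0
    exact ⟨m, hmL, hm0, fun p hp => absurd hp (Finset.notMem_empty p)⟩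
  | insert q S hqS ih =>
    obtain ⟨m, hmL, hm0, hm⟩ := ih fun p hp => hS p (Finset.mem_insert_of_mem hp)
    have hq : q.Prime := hS q (Finset.mem_insert_self q S)
    by_cases hex : ∃ y₀ : K, IsIntegral ℤ y₀ ∧ (q : K) * y₀ ∈ O ∧ y₀ ∉ O
    · obtain ⟨y₀, hy₀, hqy₀, hy₀O⟩ := hex
      obtain ⟨w, hwL, hw⟩ := exists_not_bad hO hθint hOeq hq hy₀ hqy₀ hy₀O
      -- `N = ∏ S` is prime to `q`
      set N : ℕ := ∏ p ∈ S, p with hN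
      have hcop : Nat.Coprime N q := by
        rw [hN]
        refine Nat.Coprime.prod_left fun p hp => ?_
        exact (Nat.coprime_primes (hS p (Finset.mem_insert_of_mem hp)) hq).2
          (fun h => hqS (h ▸ hp))
      obtain ⟨a, b, hab⟩ := Nat.isCoprime_iff_coprime.2 hcop
      refine ⟨w - (b * q) • (w - m), L.sub_mem hwL (L.smul_mem _ (L.sub_mem hwL hmL)), ?_, ?_⟩
      · -- non-zero: `0` is bad at `q` (witness `y₀`), the new vector is not
        intro h0
        apply hw
        have hbad0 : ∃ y : K, IsIntegral ℤ y ∧ (q : K) * y ∈ O ∧ y ∉ O ∧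
            y • (w + (-(b * q)) • (w - m)) ∈ L := by
          rw [neg_smul, ← sub_eq_add_neg, h0]
          exact ⟨y₀, hy₀, hqy₀, hy₀O, by rw [smul_zero]; exact L.zero_mem⟩
        exact (bad_add_smul_iff hO (Dvd.intro_left _ (by ring : -b * (q : ℤ) = -(b * q))) w
          (L.sub_mem hwL hmL)).1 hbad0
      · intro p hp
        rcases Finset.mem_insert.1 hp with rfl | hp
        · -- at `q`: the new vector is `w` up to `qL`
          intro hbad
          apply hw
          have e : w - (b * (p : ℤ)) • (w - m) = w + (-(b * p)) • (w - m) := by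
            rw [neg_smul, sub_eq_add_neg]
          rw [e] at hbad
          exact (bad_add_smul_iff hO (Dvd.intro_left _ (by ring : -b * (p : ℤ) = -(b * p))) w
            (L.sub_mem hwL hmL)).1 hbad
        · -- at `p ∈ S`: the new vector is `m` up to `NL ⊆ pL`
          intro hbad
          apply hm p hp
          have e : w - (b * (q : ℤ)) • (w - m) = m + (a * N) • (w - m) := by
            have hab' : (b : ℤ) * q = 1 - a * N := by linarith
            rw [hab', sub_smul, one_smul]; abel
          rw [e] at hbad
          have hpN : (p : ℤ) ∣ a * N := Dvd.dvd.mul_left (Int.natCast_dvd_natCast.2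
            (hN ▸ Finset.dvd_prod_of_mem _ hp)) a
          exact (bad_add_smul_iff hO hpN m (L.sub_mem hwL hmL)).1 hbad
    · exact ⟨m, hmL, hm0, fun p hp => by
        rcases Finset.mem_insert.1 hp with rfl | hp
        · rintro ⟨y, hy, hpy, hyO, -⟩; exact hex ⟨y, hy, hpy, hyO⟩
        · exact hm p hp⟩

/-- **Existence of a GOOD vector.** For a finitely generated, non-zero lattice `L ⊆ V` with multiplier
order `O = R(L) = ℤ + ℤθ` there is a non-zero `m ∈ L` whose coefficient lattice `I_m = {x : xm ∈ L}`
has multiplier order `R(I_m) ⊆ O` (hence `= O`): take `m` bad at no prime dividing the uniform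
denominator `D` of `𝓞_K` over `O`; if `x ∈ R(I_m) ∖ O` and `e` is least with `ex ∈ O`, a prime
`p ∣ e` yields the witness `y = (e/p)x` (integral, `py ∈ O`, `y ∉ O`, `ym ∈ L`), a contradiction.
This replaces the first summand of Borevich–Faddeev's normal form `M ≅ I₁ ⊕ ⋯ ⊕ Iₙ`, `R(I₁) = R(M)`.
[cite: JKPRST2018IsogenousPowerElliptic, §3.2 Thm. 3.2 (1), p. 6] -/
theorem exists_good_vector (h2 : finrank ℚ K = 2) (hL : L.FG) (hL0 : L ≠ ⊥)
    (hO : ∀ x : K, x ∈ O ↔ ∀ v ∈ L, x • v ∈ L) {θ : K} (hθ : ∀ q : ℚ, (q : K) ≠ θ)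
    (hOeq : O = Submodule.span ℤ ({1, θ} : Set K)) :
    ∃ m ∈ L, m ≠ 0 ∧ ∀ x : K, (∀ z : K, z • m ∈ L → (x * z) • m ∈ L) → x ∈ O := by
  classical
  have hθO : θ ∈ O := by rw [hOeq]; exact QuadraticLattice.self_mem_span_one_pair θ
  have hθint : IsIntegral ℤ θ := isIntegral_of_mem_multiplier hL hL0 hO hθO
  have h1O : (1 : K) ∈ O := by rw [hOeq]; exact QuadraticLattice.one_mem_span_one_pair θ
  obtain ⟨D, hDpos, hD⟩ := exists_nat_mul_mem_of_isIntegral h2 hθ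
  obtain ⟨m, hmL, hm0, hm⟩ := exists_forall_not_bad hL0 hO hθint hOeq D.primeFactors
    fun p hp => Nat.prime_of_mem_primeFactors hp
  refine ⟨m, hmL, hm0, fun x hx => ?_⟩
  -- `R(I_m)` as a subalgebra, finitely generated as a `ℤ`-module: its elements are integral
  obtain ⟨J, hJ⟩ := exists_coeff (K := K) L m
  let S : Subalgebra ℤ K :=
    { carrier := {x : K | ∀ z : K, z • m ∈ L → (x * z) • m ∈ L},
      mul_mem' := fun {a b} ha hb z hz => by rw [mul_assoc]; exact ha _ (hb z hz),
      one_mem' := fun z hz => by rw [one_mul]; exact hz,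
      add_mem' := fun {a b} ha hb z hz => by rw [add_mul, add_smul]; exact L.add_mem (ha z hz) (hb z hz),
      zero_mem' := fun z _ => by rw [zero_mul, zero_smul]; exact L.zero_mem,
      algebraMap_mem' := fun n z hz => by
        rw [algebraMap_int_eq, Int.coe_castRingHom, mul_smul, intCast_smul_eq]; exact L.smul_mem n hz }
  have hxS : x ∈ S := hx
  have hSJ : Subalgebra.toSubmodule S ≤ J := by
    intro a ha
    have ha' : ∀ z : K, z • m ∈ L → (a * z) • m ∈ L := ha
    have := ha' 1 (by rw [one_smul]; exact hmL)
    rw [mul_one] at this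
    exact (hJ a).2 this
  have hSfg : (Subalgebra.toSubmodule S).FG := fg_of_le hSJ (fg_coeff hL hm0 hJ)
  have hSint : ∀ a ∈ S, IsIntegral ℤ a := fun a ha => IsIntegral.of_mem_of_fg S hSfg a ha
  have hSm : ∀ a ∈ S, a • m ∈ L := fun a ha => by
    have ha' : ∀ z : K, z • m ∈ L → (a * z) • m ∈ L := ha
    have := ha' 1 (by rw [one_smul]; exact hmL)
    rwa [mul_one] at this
  by_contra hxO
  -- the least `e > 0` with `e x ∈ O`; it divides `D`
  have hex : ∃ e : ℕ, 0 < e ∧ ((e : ℕ) : K) * x ∈ O := ⟨D, hDpos, hOeq ▸ hD x (hSint x hxS)⟩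
  let e := Nat.find hex
  have hepos : 0 < e := (Nat.find_spec hex).1
  have hex_mem : ((e : ℕ) : K) * x ∈ O := (Nat.find_spec hex).2
  have hemin : ∀ e' : ℕ, 0 < e' → ((e' : ℕ) : K) * x ∈ O → e ≤ e' := fun e' h1 h2 =>
    Nat.find_min' hex ⟨h1, h2⟩
  have he1 : e ≠ 1 := by
    intro h1
    rw [h1, Nat.cast_one, one_mul] at hex_mem
    exact hxO hex_mem
  obtain ⟨p, hp, hpe⟩ := Nat.exists_prime_and_dvd he1
  have heD : e ∣ D := by
    have hr : ((D % e : ℕ) : K) * x ∈ O := by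
      have hcast : ((D : ℕ) : K) = ((e : ℕ) : K) * ((D / e : ℕ) : K) + ((D % e : ℕ) : K) := by
        exact_mod_cast (Nat.div_add_mod D e).symm
      have eD : ((D % e : ℕ) : K) * x =
          ((D : ℕ) : K) * x - ((D / e : ℕ) : ℤ) • (((e : ℕ) : K) * x) := by
        rw [zsmul_eq_mul, Int.cast_natCast, hcast]; ring
      rw [eD]
      exact O.sub_mem (hOeq ▸ hD x (hSint x hxS)) (O.smul_mem _ hex_mem)
    by_contra hnd
    have hpos : 0 < D % e := Nat.pos_of_ne_zero fun h0 => hnd (Nat.dvd_of_mod_eq_zero h0)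
    exact absurd (hemin _ hpos hr) (not_le.2 (Nat.mod_lt D hepos))
  have hpD : p ∈ D.primeFactors := Nat.mem_primeFactors.2 ⟨hp, hpe.trans heD, hDpos.ne'⟩
  -- the witness `y = (e/p) x`
  obtain ⟨f, hf⟩ := hpe
  have hfpos : 0 < f := Nat.pos_of_ne_zero fun h0 => by rw [hf, h0, mul_zero] at hepos; exact lt_irrefl 0 hepos
  have hflt : f < e := by
    rw [hf]
    exact (Nat.lt_mul_iff_one_lt_left hfpos).2 hp.one_lt
  apply hm p hpD
  refine ⟨((f : ℕ) : K) * x, ?_, ?_, ?_, ?_⟩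
  · have ef : ((f : ℕ) : K) = algebraMap ℤ K (f : ℤ) := by simp
    rw [ef]
    exact (isIntegral_algebraMap (R := ℤ) (x := (f : ℤ))).mul (hSint x hxS)
  · have ep : (p : K) * (((f : ℕ) : K) * x) = ((e : ℕ) : K) * x := by
      rw [hf, Nat.cast_mul, mul_assoc]
    rw [ep]
    exact hex_mem
  · exact fun h => absurd (hemin f hfpos h) (not_le.2 hflt)
  · exact hSm _ (S.mul_mem (natCast_mem S f) hxS)

end GoodVector

/-! ## §4. The Gorenstein pairing of `ℤ[θ]` and the splitting `L = I_m·m ⊕ L₂` off a good vector -/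

section Splitting

variable {K : Type*} [Field K] [CharZero K]
variable {V : Type*} [AddCommGroup V] [Module K V]

omit [CharZero K] [Module K V] in
/-- **A saturated rank-two piece is a direct summand, functional form**: if `ℤm + ℤn` is saturated in the
finitely generated `ℤ`-module `W ⊆ V` (`V` torsion-free, `m, n` independent), there is a `ℤ`-linear
`g : W → ℤ` with `g(m) = 0`, `g(n) = 1`.  Proof by the Smith normal form of `ℤm + ℤn ≤ W` (Mathlib):
the adapted basis vectors `uᵢ` of `W` lie in the saturated `ℤm + ℤn`; writing `uᵢ = qᵢm + qᵢ'n`,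
`g = Σᵢ qᵢ'·uᵢ*` works. [folklore] -/
private theorem exists_int_functional (htf : ∀ (k : ℤ) (v : V), k • v = 0 → k = 0 ∨ v = 0)
    {W : Submodule ℤ V} (hW : W.FG) {m n : V} (hm : m ∈ W) (hn : n ∈ W)
    (hli : LinearIndependent ℤ ![m, n])
    (hsat : ∀ w ∈ W, ∀ k : ℤ, k ≠ 0 → k • w ∈ Submodule.span ℤ ({m, n} : Set V) →
      w ∈ Submodule.span ℤ ({m, n} : Set V)) :
    ∃ g : W →ₗ[ℤ] ℤ, g ⟨m, hm⟩ = 0 ∧ g ⟨n, hn⟩ = 1 := by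
  classical
  haveI : Module.Finite ℤ W := Module.Finite.iff_fg.2 hW
  haveI : IsTorsionFree ℤ W := by
    refine Module.IsTorsionFree.of_smul_eq_zero fun k w hkw => ?_
    rcases htf k (w : V) (by rw [← Submodule.coe_smul_of_tower, hkw, Submodule.coe_zero]) with h | h
    · exact Or.inl h
    · exact Or.inr (Subtype.ext h)
  haveI : Module.Free ℤ W := Module.free_of_finite_type_torsion_free'
  -- the saturated submodule `N = ℤm + ℤn` of `W`
  set N : Submodule ℤ W := Submodule.span ℤ ({⟨m, hm⟩, ⟨n, hn⟩} : Set W) with hN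
  have hNmem : ∀ w : W, w ∈ N ↔ (w : V) ∈ Submodule.span ℤ ({m, n} : Set V) := by
    intro w
    rw [hN, Submodule.mem_span_pair, Submodule.mem_span_pair]
    constructor
    · rintro ⟨a, b, h⟩
      exact ⟨a, b, by rw [← congrArg Subtype.val h]; simp⟩
    · rintro ⟨a, b, h⟩
      exact ⟨a, b, Subtype.ext (by simp [h])⟩
  have hsatN : ∀ w : W, ∀ k : ℤ, k ≠ 0 → k • w ∈ N → w ∈ N := fun w k hk hkw => by
    rw [hNmem] at hkw ⊢
    exact hsat w w.2 k hk (by simpa using hkw)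
  -- Smith normal form of `N ≤ W`
  obtain ⟨r, snf⟩ := Submodule.smithNormalForm (Module.Free.chooseBasis ℤ W) N
  let u : Fin r → W := fun i => snf.bM (snf.f i)
  have huN : ∀ i, u i ∈ N := by
    intro i
    have ha : snf.a i ≠ 0 := by
      intro h0
      have h1 := snf.snf i
      rw [h0, zero_smul] at h1
      exact snf.bN.ne_zero i (Subtype.ext h1)
    exact hsatN (u i) (snf.a i) ha (by rw [← snf.snf i]; exact (snf.bN i).2)
  -- every `x ∈ N` is `Σᵢ (bM.repr x (f i)) • uᵢ`
  have hexp : ∀ x : W, x ∈ N → x = ∑ i, (snf.bM.repr x (snf.f i)) • u i := by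
    intro x hx
    have h1 : x = ∑ j, snf.bM.repr x j • snf.bM j := (snf.bM.sum_repr x).symm
    have h2 : ∑ j ∈ Finset.univ.map snf.f, snf.bM.repr x j • snf.bM j =
        ∑ j, snf.bM.repr x j • snf.bM j := by
      apply Finset.sum_subset (Finset.subset_univ _)
      intro j _ hj
      have hj' : j ∉ Set.range snf.f := by
        rintro ⟨i, rfl⟩
        exact hj (Finset.mem_map_of_mem _ (Finset.mem_univ i))
      have h0 : snf.bM.repr x j = 0 := snf.repr_eq_zero_of_notMem_range ⟨x, hx⟩ hj'
      rw [h0, zero_smul]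
    conv_lhs => rw [h1, ← h2, Finset.sum_map]
  -- `uᵢ = qᵢ m + qᵢ' n`
  have hmN : (⟨m, hm⟩ : W) ∈ N := Submodule.subset_span (Set.mem_insert _ _)
  have hnN : (⟨n, hn⟩ : W) ∈ N := Submodule.subset_span (Set.mem_insert_of_mem _ rfl)
  have huq : ∀ i, ∃ q q' : ℤ, q • (⟨m, hm⟩ : W) + q' • (⟨n, hn⟩ : W) = u i := fun i => by
    have := huN i
    rw [hN, Submodule.mem_span_pair] at this
    exact this
  choose q q' hqq' using huq
  -- independence of `m, n` inside `W`
  have hliW : LinearIndependent ℤ ![(⟨m, hm⟩ : W), ⟨n, hn⟩] := by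
    have : (W.subtype : W →ₗ[ℤ] V) ∘ ![(⟨m, hm⟩ : W), ⟨n, hn⟩] = ![m, n] := by
      funext i; fin_cases i <;> rfl
    exact LinearIndependent.of_comp W.subtype (by rw [this]; exact hli)
  let g : W →ₗ[ℤ] ℤ := ∑ i, q' i • snf.bM.coord (snf.f i)
  have hg : ∀ x : W, g x = ∑ i, snf.bM.repr x (snf.f i) * q' i := by
    intro x
    rw [LinearMap.sum_apply]
    exact Finset.sum_congr rfl fun i _ => by
      rw [LinearMap.smul_apply, Basis.coord_apply, smul_eq_mul, mul_comm]
  -- substitute `uᵢ = qᵢ m + qᵢ' n` into the expansion of `x ∈ N`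
  have key : ∀ x : W, x ∈ N →
      (∑ i, snf.bM.repr x (snf.f i) * q i) • (⟨m, hm⟩ : W) +
          (∑ i, snf.bM.repr x (snf.f i) * q' i) • (⟨n, hn⟩ : W) = x := by
    intro x hx
    conv_rhs => rw [hexp x hx]
    simp_rw [← hqq', smul_add, smul_smul, Finset.sum_add_distrib, Finset.sum_smul]
  have coef : ∀ x : W, x ∈ N → ∀ a b : ℤ, a • (⟨m, hm⟩ : W) + b • (⟨n, hn⟩ : W) = x →
      (∑ i, snf.bM.repr x (snf.f i) * q' i) = b := by
    intro x hx a b hab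
    have h0 : (a - ∑ i, snf.bM.repr x (snf.f i) * q i) • (⟨m, hm⟩ : W) +
        (b - ∑ i, snf.bM.repr x (snf.f i) * q' i) • (⟨n, hn⟩ : W) = 0 := by
      rw [sub_smul, sub_smul, sub_add_sub_comm, hab, key x hx, sub_self]
    exact (sub_eq_zero.1 ((LinearIndependent.pair_iff.1 hliW) _ _ h0).2).symm
  refine ⟨g, ?_, ?_⟩
  · rw [hg]
    exact coef _ hmN 1 0 (by rw [one_smul, zero_smul, add_zero])
  · rw [hg]
    exact coef _ hnN 0 1 (by rw [zero_smul, one_smul, zero_add])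

/-- **The Gorenstein pairing of `O = ℤ[θ]` at work**: `λ(a + bθ) = b` is a perfect pairing
`(x, y) ↦ λ(xy)` on `O`, so a `ℤ`-linear `g : W → ℤ` on an `O`-stable lattice `W` produces the
`O`-LINEAR `φ(w) = (g(θw) − t·g(w)) + g(w)θ : W → O` (`θ² = tθ + n`) with `λ ∘ φ = g`.  With `g(m) = 0`,
`g(θm) = 1` (available when `Om` is saturated in `W`, `exists_int_functional`) one gets `φ(m) = 1`.
The form is returned as a function on `V` (values off `W` unspecified). [folklore] -/
private theorem exists_multiplier_linear_form (htf : ∀ (k : ℤ) (v : V), k • v = 0 → k = 0 ∨ v = 0)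
    {θ : K} (hθ : ∀ q : ℚ, (q : K) ≠ θ) {t n : ℤ} (hθθ : θ * θ = t * θ + n)
    {W : Submodule ℤ V} (hW : W.FG)
    (hOW : ∀ x ∈ Submodule.span ℤ ({1, θ} : Set K), ∀ w ∈ W, x • w ∈ W)
    {m : V} (hmW : m ∈ W) (hm0 : m ≠ 0)
    (hsat : ∀ x : K, x • m ∈ W → x ∈ Submodule.span ℤ ({1, θ} : Set K)) :
    ∃ φ : V → K, (∀ w₁ ∈ W, ∀ w₂ ∈ W, φ (w₁ + w₂) = φ w₁ + φ w₂) ∧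
      (∀ x ∈ Submodule.span ℤ ({1, θ} : Set K), ∀ w ∈ W, φ (x • w) = x * φ w) ∧
      (∀ w ∈ W, φ w ∈ Submodule.span ℤ ({1, θ} : Set K)) ∧ φ m = 1 := by
  classical
  have hθO : θ ∈ Submodule.span ℤ ({1, θ} : Set K) := QuadraticLattice.self_mem_span_one_pair θ
  have hθmW : θ • m ∈ W := hOW θ hθO m hmW
  -- `m, θm` independent and `ℤm + ℤθm = W ∩ Km` saturated
  have hli : LinearIndependent ℤ ![m, θ • m] := by
    rw [LinearIndependent.pair_iff]
    intro a b hab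
    have h : ((a : K) + b * θ) • m = 0 := by
      rw [add_smul, mul_smul, intCast_smul_eq, intCast_smul_eq]; exact hab
    rcases smul_eq_zero.1 h with h | h
    · have h' : ((a : ℤ) : K) + (b : ℤ) * θ = (0 : ℤ) + (0 : ℤ) * θ := by rw [h]; push_cast; ring
      obtain ⟨ha, hb⟩ := QuadraticLattice.intCast_add_intCast_mul_inj hθ h'
      exact ⟨ha, hb⟩
    · exact absurd h hm0
  have hsat' : ∀ w ∈ W, ∀ k : ℤ, k ≠ 0 → k • w ∈ Submodule.span ℤ ({m, θ • m} : Set V) →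
      w ∈ Submodule.span ℤ ({m, θ • m} : Set V) := by
    intro w hw k hk hkw
    obtain ⟨a, b, hab⟩ := Submodule.mem_span_pair.1 hkw
    have hk' : (k : K) ≠ 0 := by exact_mod_cast hk
    set x : K := (k : K)⁻¹ * (a + b * θ) with hx
    have hxw : x • m = w := by
      rw [hx, mul_smul, add_smul, mul_smul, intCast_smul_eq, intCast_smul_eq, hab,
        ← intCast_smul_eq (K := K) k, smul_smul, inv_mul_cancel₀ hk', one_smul]
    have hxO : x ∈ Submodule.span ℤ ({1, θ} : Set K) := hsat x (by rw [hxw]; exact hw)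
    obtain ⟨a', b', hab'⟩ := QuadraticLattice.mem_span_one_pair_iff.1 hxO
    rw [Submodule.mem_span_pair]
    refine ⟨a', b', ?_⟩
    rw [← hxw, hab', add_smul, mul_smul, intCast_smul_eq, intCast_smul_eq]
  obtain ⟨g, hg0, hg1⟩ := exists_int_functional htf hW hmW hθmW hli hsat'
  -- `θ` acting on `W`, and the form `φ`
  have hθW : ∀ w : W, θ • (w : V) ∈ W := fun w => hOW θ hθO _ w.2
  let θW : W → W := fun w => ⟨θ • (w : V), hθW w⟩
  have hθWadd : ∀ w₁ w₂ : W, θW (w₁ + w₂) = θW w₁ + θW w₂ := fun w₁ w₂ =>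
    Subtype.ext (by simp [θW, smul_add])
  have hθWsmul : ∀ (k : ℤ) (w : W), θW (k • w) = k • θW w := fun k w =>
    Subtype.ext (by simp [θW, smul_comm θ k (w : V)])
  have hθWθW : ∀ w : W, θW (θW w) = t • θW w + n • w := fun w => Subtype.ext (by
    simp only [θW, Submodule.coe_add, Submodule.coe_smul_of_tower]
    rw [smul_smul, hθθ, add_smul, mul_smul, intCast_smul_eq, intCast_smul_eq])
  let φW : W → K := fun w => ((g (θW w) - t * g w : ℤ) : K) + (g w : K) * θ
  have hφWadd : ∀ w₁ w₂ : W, φW (w₁ + w₂) = φW w₁ + φW w₂ := by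
    intro w₁ w₂
    simp only [φW, hθWadd, map_add]
    push_cast; ring
  have hφWsmul : ∀ (k : ℤ) (w : W), φW (k • w) = k * φW w := by
    intro k w
    simp only [φW, hθWsmul, map_zsmul, smul_eq_mul]
    push_cast; ring
  have hφWθ : ∀ w : W, φW (θW w) = θ * φW w := by
    intro w
    simp only [φW, hθWθW, map_add, map_zsmul, smul_eq_mul]
    push_cast
    linear_combination (-(g w : K)) * hθθ
  -- the form on `V`
  let φ : V → K := fun v => if hv : v ∈ W then φW ⟨v, hv⟩ else 0
  have hφ : ∀ (v : V) (hv : v ∈ W), φ v = φW ⟨v, hv⟩ := fun v hv => dif_pos hv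
  refine ⟨φ, fun w₁ hw₁ w₂ hw₂ => ?_, fun x hx w hw => ?_, fun w hw => ?_, ?_⟩
  · rw [hφ w₁ hw₁, hφ w₂ hw₂, hφ (w₁ + w₂) (W.add_mem hw₁ hw₂)]
    exact hφWadd ⟨w₁, hw₁⟩ ⟨w₂, hw₂⟩
  · obtain ⟨a, b, rfl⟩ := QuadraticLattice.mem_span_one_pair_iff.1 hx
    have hmem : ((a : K) + b * θ) • w ∈ W := hOW _ hx w hw
    rw [hφ _ hmem, hφ w hw]
    have e : (⟨((a : K) + b * θ) • w, hmem⟩ : W) = a • ⟨w, hw⟩ + b • θW ⟨w, hw⟩ :=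
      Subtype.ext (by
        simp only [θW, Submodule.coe_add, Submodule.coe_smul_of_tower]
        rw [add_smul, mul_smul, intCast_smul_eq, intCast_smul_eq])
    rw [e, hφWadd, hφWsmul, hφWsmul, hφWθ]
    ring
  · rw [hφ w hw, QuadraticLattice.mem_span_one_pair_iff]
    exact ⟨_, _, rfl⟩
  · rw [hφ m hmW]
    change ((g (θW ⟨m, hmW⟩) - t * g ⟨m, hmW⟩ : ℤ) : K) + (g ⟨m, hmW⟩ : K) * θ = 1
    have e : θW ⟨m, hmW⟩ = ⟨θ • m, hθmW⟩ := rfl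
    rw [e, hg0, hg1]
    push_cast; ring

/-- **THE SPLITTING STEP `L = I_m·m ⊕ L₂`.**  Let `L ⊆ V` be a finitely generated lattice with
multiplier order `O = R(L) = ℤ + ℤθ` and `m ∈ L ∖ 0` a GOOD vector (`R(I_m) ⊆ O`).  Then the coefficient
lattice `J = I_m = ℤα + ℤβ` is invertible for `O` (`JJ′ = O`, Cox Prop. 7.4), the lattice `W = J′L`
is `O`-stable with `W ∩ Km = Om` saturated, the `O`-linear form `φ : W → O` with `φ(m) = 1` of
`exists_multiplier_linear_form` extends to `ψ = d⁻¹φ(d·) : L → J` (`d ∈ J′ ∩ ℤ ∖ 0`) with `ψ(xm) = x`,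
and `L₂ = L ∩ ker ψ` is a `θ`-stable complement: `L = Jm ⊕ L₂`, `m ∉ KL₂`.
[cite: JKPRST2018IsogenousPowerElliptic, §3.2 Thm. 3.2 (1), p. 6] [cite: Cox2013, §7.A Prop. 7.4, p. 135] -/
theorem exists_splitting (h2 : finrank ℚ K = 2) {L : Submodule ℤ V} (hL : L.FG) {O : Submodule ℤ K}
    (hO : ∀ x : K, x ∈ O ↔ ∀ v ∈ L, x • v ∈ L) {θ : K} (hθ : ∀ q : ℚ, (q : K) ≠ θ)
    (hOeq : O = Submodule.span ℤ ({1, θ} : Set K)) {m : V} (hmL : m ∈ L) (hm0 : m ≠ 0)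
    (hgood : ∀ x : K, (∀ z : K, z • m ∈ L → (x * z) • m ∈ L) → x ∈ O) :
    ∃ (α β : K) (L₂ : Submodule ℤ V), LinearIndependent ℚ ![α, β] ∧
      (∀ x : K, x ∈ Submodule.span ℤ ({α, β} : Set K) ↔ x • m ∈ L) ∧
      L₂ ≤ L ∧ (∀ v ∈ L₂, θ • v ∈ L₂) ∧ m ∉ Submodule.span K (L₂ : Set V) ∧
      ∀ v : V, v ∈ L ↔ ∃ x ∈ Submodule.span ℤ ({α, β} : Set K), ∃ w ∈ L₂, v = x • m + w := by
  classical
  have htf : ∀ (k : ℤ) (v : V), k • v = 0 → k = 0 ∨ v = 0 := by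
    intro k v hkv
    rw [← intCast_smul_eq (K := K)] at hkv
    rcases smul_eq_zero.1 hkv with h | h
    · exact Or.inl (by exact_mod_cast h)
    · exact Or.inr h
  have h1O : (1 : K) ∈ O := by rw [hOeq]; exact QuadraticLattice.one_mem_span_one_pair θ
  have hθO : θ ∈ O := by rw [hOeq]; exact QuadraticLattice.self_mem_span_one_pair θ
  have hOL : ∀ x ∈ O, ∀ v ∈ L, x • v ∈ L := fun x hx => (hO x).1 hx
  -- `θ² = tθ + n`
  have hθθO : θ * θ ∈ O := (hO _).2 fun v hv => by rw [mul_smul]; exact hOL θ hθO _ (hOL θ hθO v hv)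
  obtain ⟨t, n, hθθ⟩ : ∃ t n : ℤ, θ * θ = t * θ + n := by
    rw [hOeq, QuadraticLattice.mem_span_one_pair_iff] at hθθO
    obtain ⟨n, t, hnt⟩ := hθθO
    exact ⟨t, n, by rw [hnt]; ring⟩
  -- (a) the coefficient lattice `J = I_m = ℤα + ℤβ`
  obtain ⟨J, hJ⟩ := exists_coeff (K := K) L m
  have hJfg : J.FG := fg_coeff hL hm0 hJ
  have h1J : (1 : K) ∈ J := (hJ 1).2 (by rw [one_smul]; exact hmL)
  have hθJ : θ ∈ J := (hJ θ).2 (hOL θ hθO m hmL)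
  obtain ⟨r, β, hr0, -, hJeq, hli⟩ := exists_eq_span_ratCast_pair h2 hθ hJfg h1J hθJ
  have hα0 : ((r : ℚ) : K) ≠ 0 := by exact_mod_cast hr0
  -- (b) Cox: `J` is invertible for its own order, which is `O`
  obtain ⟨a, b, c, τ, ha, hrel, ⟨u, v, w, hbez⟩, hτ, -, hJJ, hJinv⟩ :=
    QuadraticLattice.exists_order_eq_and_mul_inv_eq h2 hli
  rw [← hJeq] at hJJ hJinv
  set J' : Submodule ℤ K := (((a : K) / (r : K)) • Submodule.span ℤ ({1, -(b : K) / a - τ} : Set K))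
    with hJ'def
  have hOJ : ∀ x ∈ O, ∀ z ∈ J, x * z ∈ J := fun x hx z hz =>
    (hJ _).2 (by rw [mul_smul]; exact hOL x hx _ ((hJ z).1 hz))
  have hJdivJ : J / J = O := by
    ext x
    rw [Submodule.mem_div_iff_forall_mul_mem]
    constructor
    · intro h
      exact hgood x fun z hz => (hJ _).1 (h z ((hJ z).2 hz))
    · intro hx z hz
      exact hOJ x hx z hz
  have hOeq' : Submodule.span ℤ ({1, (a : K) * τ} : Set K) = O := hJJ.symm.trans hJdivJ
  have hJJ' : J * J' = O := hJinv.trans hOeq'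
  have hJ'J : J' * J = O := by rw [Submodule.mul_comm]; exact hJJ'
  have hJ'O : J' ≤ O := fun y hy => by
    have := Submodule.mul_mem_mul hy h1J
    rw [mul_one, hJ'J] at this
    exact this
  have hOJ' : ∀ x ∈ O, ∀ y ∈ J', x * y ∈ J' := by
    have hdiv : J' / J' = O :=
      (QuadraticLattice.inv_div_self hα0 ha hrel hbez hτ).trans hOeq'
    intro x hx y hy
    rw [← hdiv, Submodule.mem_div_iff_forall_mul_mem] at hx
    exact hx y hy
  -- a non-zero integer `d ∈ J'` (`d = y·ȳ` for any `y ∈ J' ∖ 0`)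
  obtain ⟨d, hd0, hdJ'⟩ : ∃ d : ℤ, d ≠ 0 ∧ (d : K) ∈ J' := by
    have hJ'0 : J' ≠ ⊥ := by
      intro h0
      rw [h0, Submodule.mul_bot] at hJJ'
      exact one_ne_zero ((Submodule.mem_bot ℤ).1 (hJJ' ▸ h1O : (1 : K) ∈ (⊥ : Submodule ℤ K)))
    obtain ⟨y, hyJ', hy0⟩ := Submodule.exists_mem_ne_zero_of_ne_bot hJ'0
    have hyO : y ∈ Submodule.span ℤ ({1, θ} : Set K) := hOeq ▸ hJ'O hyJ'
    obtain ⟨p, q, hpq⟩ := QuadraticLattice.mem_span_one_pair_iff.1 hyO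
    -- the conjugate `ȳ = (p + qt) − qθ ∈ O`
    have hybar : ((p + q * t : ℤ) : K) + ((-q : ℤ) : K) * θ ∈ O := by
      rw [hOeq, QuadraticLattice.mem_span_one_pair_iff]; exact ⟨_, _, rfl⟩
    refine ⟨p * p + p * q * t - n * q * q, ?_, ?_⟩
    · intro hd
      have hybar0 : ((p + q * t : ℤ) : K) + ((-q : ℤ) : K) * θ ≠ 0 := by
        intro h0
        have h0' : ((p + q * t : ℤ) : K) + ((-q : ℤ) : K) * θ = (0 : ℤ) + (0 : ℤ) * θ := by
          rw [h0]; push_cast; ring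
        obtain ⟨h₁, h₂⟩ := QuadraticLattice.intCast_add_intCast_mul_inj hθ h0'
        have hq : q = 0 := by linarith
        have hp : p = 0 := by rw [hq] at h₁; simpa using h₁
        apply hy0
        rw [hpq, hp, hq]; push_cast; ring
      have hprod : y * (((p + q * t : ℤ) : K) + ((-q : ℤ) : K) * θ) =
          ((p * p + p * q * t - n * q * q : ℤ) : K) := by
        rw [hpq]; push_cast; linear_combination (-((q : K) * q)) * hθθ
      rw [hd, Int.cast_zero, mul_eq_zero] at hprod
      rcases hprod with h | h
      · exact hy0 h
      · exact hybar0 h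
    · have hprod : ((p * p + p * q * t - n * q * q : ℤ) : K) =
          (((p + q * t : ℤ) : K) + ((-q : ℤ) : K) * θ) * y := by
        rw [hpq]; push_cast; linear_combination ((q : K) * q) * hθθ
      rw [hprod]
      exact hOJ' _ hybar y hyJ'
  -- (c) the `O`-stable lattice `W = J'L ≤ L`
  set W : Submodule ℤ V := J' • L with hWdef
  have hWL : W ≤ L := Submodule.smul_le.2 fun y hy v hv => hOL y (hJ'O hy) v hv
  have hWfg : W.FG := fg_of_le hWL hL
  have hOW : ∀ x ∈ Submodule.span ℤ ({1, θ} : Set K), ∀ w ∈ W, x • w ∈ W := by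
    intro x hx w hw
    rw [← hOeq] at hx
    refine Submodule.smul_induction_on hw (fun y hy v hv => ?_) (fun w₁ w₂ h₁ h₂ => ?_)
    · rw [smul_smul]; exact Submodule.smul_mem_smul (hOJ' x hx y hy) hv
    · rw [smul_add]; exact W.add_mem h₁ h₂
  have hJW : ∀ z ∈ J, ∀ w ∈ W, z • w ∈ L := by
    intro z hz w hw
    refine Submodule.smul_induction_on hw (fun y hy v hv => ?_) (fun w₁ w₂ h₁ h₂ => ?_)
    · rw [smul_smul]
      exact hOL _ (hJJ' ▸ Submodule.mul_mem_mul hz hy) v hv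
    · rw [smul_add]; exact L.add_mem h₁ h₂
  have hOmW : ∀ x ∈ O, x • m ∈ W := by
    intro x hx
    rw [← hJJ'] at hx
    refine Submodule.mul_induction_on hx (fun z hz y hy => ?_) (fun x₁ x₂ h₁ h₂ => ?_)
    · rw [mul_comm, mul_smul]; exact Submodule.smul_mem_smul hy ((hJ z).1 hz)
    · rw [add_smul]; exact W.add_mem h₁ h₂
  have hmW : m ∈ W := by simpa using hOmW 1 h1O
  have hsatW : ∀ x : K, x • m ∈ W → x ∈ Submodule.span ℤ ({1, θ} : Set K) := by
    intro x hx
    rw [← hOeq]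
    exact hgood x fun z hz => by rw [mul_comm, mul_smul]; exact hJW z ((hJ z).2 hz) _ hx
  -- (d) the `O`-linear form `φ : W → O` with `φ(m) = 1`, and `ψ = d⁻¹ φ(d ·)` on `L`
  obtain ⟨φ, hφadd, hφO, hφmem, hφm⟩ :=
    exists_multiplier_linear_form htf hθ hθθ hWfg hOW hmW hm0 hsatW
  have hdL : ∀ x ∈ L, (d : ℤ) • x ∈ W := fun x hx => by
    rw [← intCast_smul_eq (K := K)]; exact Submodule.smul_mem_smul hdJ' hx
  have hd0K : ((d : ℤ) : K) ≠ 0 := by exact_mod_cast hd0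
  let ψ : V → K := fun x => ((d : ℤ) : K)⁻¹ * φ ((d : ℤ) • x)
  have hψadd : ∀ x₁ ∈ L, ∀ x₂ ∈ L, ψ (x₁ + x₂) = ψ x₁ + ψ x₂ := by
    intro x₁ hx₁ x₂ hx₂
    simp only [ψ, smul_add, hφadd _ (hdL x₁ hx₁) _ (hdL x₂ hx₂), mul_add]
  -- `O`-linearity of `ψ` on `L`
  have hψO : ∀ x ∈ Submodule.span ℤ ({1, θ} : Set K), ∀ y ∈ L, ψ (x • y) = x * ψ y := by
    intro x hx y hy
    simp only [ψ]
    rw [smul_comm, hφO x hx _ (hdL y hy), mul_left_comm]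
  have hψzsmul : ∀ (k : ℤ), ∀ y ∈ L, ψ (k • y) = k * ψ y := by
    intro k y hy
    have hk : ((k : ℤ) : K) ∈ Submodule.span ℤ ({1, θ} : Set K) := by
      rw [QuadraticLattice.mem_span_one_pair_iff]; exact ⟨k, 0, by push_cast; ring⟩
    rw [← intCast_smul_eq (K := K), hψO _ hk y hy]
  -- `K`-semilinearity where defined: `ψ(x y) = x ψ(y)` whenever `y, x y ∈ L`
  have hψK : ∀ (x : K), ∀ y ∈ L, x • y ∈ L → ψ (x • y) = x * ψ y := by
    intro x y hy hxy
    -- `e x ∈ O` for some integer `e > 0`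
    obtain ⟨e, hepos, he⟩ := exists_nat_mul_mem_span_one_pair h2 hθ
      (Submodule.fg_span (Set.finite_singleton x))
    have hex : ((e : ℕ) : K) * x ∈ Submodule.span ℤ ({1, θ} : Set K) :=
      he x (Submodule.mem_span_singleton_self x)
    have he0 : ((e : ℕ) : K) ≠ 0 := by exact_mod_cast hepos.ne'
    have h1 : ψ ((e : ℤ) • (x • y)) = (e : ℤ) * ψ (x • y) := hψzsmul e _ hxy
    have h2 : ψ ((e : ℤ) • (x • y)) = ((e : ℕ) : K) * x * ψ y := by
      rw [← intCast_smul_eq (K := K), smul_smul, Int.cast_natCast, hψO _ hex y hy]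
    rw [h1, Int.cast_natCast, mul_assoc] at h2
    exact mul_left_cancel₀ he0 h2
  have hψm : ψ m = 1 := by
    simp only [ψ]
    have : φ ((d : ℤ) • m) = (d : ℤ) * φ m := by
      have hk : ((d : ℤ) : K) ∈ Submodule.span ℤ ({1, θ} : Set K) := by
        rw [QuadraticLattice.mem_span_one_pair_iff]; exact ⟨d, 0, by push_cast; ring⟩
      rw [← intCast_smul_eq (K := K), hφO _ hk m hmW]
    rw [this, hφm, mul_one, inv_mul_cancel₀ hd0K]
  -- `ψ(L) ⊆ J`: `J' ψ(y) ⊆ O` and `J = {x : x J' ⊆ O}`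
  have hψJ : ∀ y ∈ L, ψ y ∈ J := by
    intro y hy
    have hJ'ψ : ∀ z ∈ J', z * ψ y ∈ O := by
      intro z hz
      have hzO : z ∈ Submodule.span ℤ ({1, θ} : Set K) := hOeq ▸ hJ'O hz
      rw [← hψO z hzO y hy]
      simp only [ψ]
      have hmem : φ ((d : ℤ) • z • y) ∈ O := by
        rw [hOeq]; exact hφmem _ (by rw [smul_comm]; exact hOW z hzO _ (hdL y hy))
      rw [hOeq] at hmem ⊢
      -- `d⁻¹ φ(d z y) = φ(z y)`? use `O`-linearity in `d` instead: `φ(d • (z•y)) = d φ(z • y)`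
      have hzy : z • y ∈ W := Submodule.smul_mem_smul hz hy
      have hk : ((d : ℤ) : K) ∈ Submodule.span ℤ ({1, θ} : Set K) := by
        rw [QuadraticLattice.mem_span_one_pair_iff]; exact ⟨d, 0, by push_cast; ring⟩
      rw [← intCast_smul_eq (K := K), hφO _ hk _ hzy, ← mul_assoc, inv_mul_cancel₀ hd0K, one_mul]
      exact hφmem _ hzy
    -- `1 ∈ O = J' J`: write `ψ y = ψ y · 1` and induct over `J' * J`
    have key : ∀ o ∈ J' * J, ψ y * o ∈ J := by
      intro o ho
      refine Submodule.mul_induction_on ho (fun z hz x hx => ?_) (fun o₁ o₂ h₁ h₂ => ?_)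
      · rw [← mul_assoc]
        exact hOJ _ (by rw [mul_comm]; exact hJ'ψ z hz) x hx
      · rw [mul_add]; exact J.add_mem h₁ h₂
    have := key 1 (hJ'J.symm ▸ h1O)
    rwa [mul_one] at this
  -- `ψ(x m) = x` for `x ∈ J`
  have hψxm : ∀ x ∈ J, ψ (x • m) = x := fun x hx => by
    rw [hψK x m hmL ((hJ x).1 hx), hψm, mul_one]
  -- (e) the complement `L₂ = L ∩ ker ψ`
  let L₂ : Submodule ℤ V :=
    { carrier := {y | y ∈ L ∧ ψ y = 0},
      zero_mem' := ⟨L.zero_mem, by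
        have := hψzsmul 0 0 L.zero_mem
        rwa [zero_smul, Int.cast_zero, zero_mul] at this⟩,
      add_mem' := fun {y₁ y₂} h₁ h₂ => ⟨L.add_mem h₁.1 h₂.1, by
        rw [hψadd _ h₁.1 _ h₂.1, h₁.2, h₂.2, add_zero]⟩,
      smul_mem' := fun k y hy => ⟨L.smul_mem k hy.1, by rw [hψzsmul k y hy.1, hy.2, mul_zero]⟩ }
  have hL₂mem : ∀ y, y ∈ L₂ ↔ y ∈ L ∧ ψ y = 0 := fun y => Iff.rfl
  refine ⟨(r : K), β, L₂, hli, fun x => by rw [← hJeq]; exact hJ x, fun y hy => hy.1,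
    fun y hy => ⟨hOL θ hθO y hy.1, by rw [hψO θ (QuadraticLattice.self_mem_span_one_pair θ) y hy.1,
      hy.2, mul_zero]⟩, ?_, fun y => ⟨fun hy => ?_, ?_⟩⟩
  · -- `m ∉ K L₂`: every `u ∈ K L₂` has `ψ(N u) = 0` for some integer `N > 0` with `N u ∈ L`
    intro hm
    have P : ∀ u ∈ Submodule.span K (L₂ : Set V), ∃ N : ℤ, N ≠ 0 ∧ N • u ∈ L ∧ ψ (N • u) = 0 := by
      intro u hu
      induction hu using Submodule.span_induction with
      | mem u hu => exact ⟨1, one_ne_zero, by rw [one_smul]; exact hu.1, by rw [one_smul]; exact hu.2⟩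
      | zero => exact ⟨1, one_ne_zero, by rw [smul_zero]; exact L.zero_mem, by
          rw [smul_zero]; have := hψzsmul 0 0 L.zero_mem
          rwa [zero_smul, Int.cast_zero, zero_mul] at this⟩
      | add u₁ u₂ _ _ h₁ h₂ =>
        obtain ⟨N₁, hN₁, hN₁L, hN₁ψ⟩ := h₁
        obtain ⟨N₂, hN₂, hN₂L, hN₂ψ⟩ := h₂
        refine ⟨N₁ * N₂, mul_ne_zero hN₁ hN₂, ?_, ?_⟩
        · rw [smul_add, mul_comm N₁ N₂, mul_smul, mul_comm N₂ N₁, mul_smul]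
          exact L.add_mem (L.smul_mem _ hN₁L) (L.smul_mem _ hN₂L)
        · rw [smul_add, mul_comm N₁ N₂, mul_smul, mul_comm N₂ N₁, mul_smul,
            hψadd _ (L.smul_mem _ hN₁L) _ (L.smul_mem _ hN₂L), hψzsmul _ _ hN₁L, hψzsmul _ _ hN₂L,
            hN₁ψ, hN₂ψ, mul_zero, mul_zero, add_zero]
      | smul x u _ hu =>
        obtain ⟨N, hN, hNL, hNψ⟩ := hu
        obtain ⟨e, hepos, he⟩ := exists_nat_mul_mem_span_one_pair h2 hθ
          (Submodule.fg_span (Set.finite_singleton x))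
        have hex : ((e : ℕ) : K) * x ∈ Submodule.span ℤ ({1, θ} : Set K) :=
          he x (Submodule.mem_span_singleton_self x)
        refine ⟨e * N, mul_ne_zero (by exact_mod_cast hepos.ne') hN, ?_, ?_⟩
        · have eq : ((e : ℤ) * N) • x • u = (((e : ℕ) : K) * x) • (N • u) := by
            rw [mul_smul, smul_comm N x u, ← intCast_smul_eq (K := K) (e : ℤ), Int.cast_natCast,
              smul_smul]
          rw [eq]
          rw [← hOeq] at hex
          exact hOL _ hex _ hNL
        · have eq : ((e : ℤ) * N) • x • u = (((e : ℕ) : K) * x) • (N • u) := by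
            rw [mul_smul, smul_comm N x u, ← intCast_smul_eq (K := K) (e : ℤ), Int.cast_natCast,
              smul_smul]
          rw [eq, hψO _ hex _ hNL, hNψ, mul_zero]
    obtain ⟨N, hN, -, hNψ⟩ := P m hm
    rw [hψzsmul N m hmL, hψm, mul_one] at hNψ
    exact hN (by exact_mod_cast hNψ)
  · -- `L ⊆ Jm + L₂`: `y = ψ(y) m + (y − ψ(y) m)`
    refine ⟨ψ y, by rw [← hJeq]; exact hψJ y hy, y - ψ y • m, ⟨L.sub_mem hy ((hJ _).1 (hψJ y hy)), ?_⟩,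
      by rw [add_sub_cancel]⟩
    have hsub : ψ (y - ψ y • m) = ψ y - ψ (ψ y • m) := by
      have e : y - ψ y • m = y + (-1 : ℤ) • (ψ y • m) := by rw [neg_one_zsmul, sub_eq_add_neg]
      rw [e, hψadd _ hy _ (L.smul_mem _ ((hJ _).1 (hψJ y hy))), hψzsmul _ _ ((hJ _).1 (hψJ y hy))]
      push_cast; ring
    rw [hsub, hψxm _ (hψJ y hy), sub_self]
  · -- `Jm + L₂ ⊆ L`
    rintro ⟨x, hx, w', hw', rfl⟩
    rw [← hJeq] at hx
    exact L.add_mem ((hJ x).1 hx) hw'.1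

end Splitting

/-! ## §5. THE DECOMPOSITION `L = I₁y₁ ⊕ ⋯ ⊕ Iₙyₙ` (induction on `dim_K KL`) -/

section Decomposition

variable {K : Type*} [Field K] [CharZero K]
variable {V : Type*} [AddCommGroup V] [Module K V]

omit [CharZero K] in
/-- The `K`-span of a finitely generated `ℤ`-lattice is finite-dimensional. [folklore] -/
private theorem finiteDimensional_span_of_fg {L : Submodule ℤ V} (hL : L.FG) :
    FiniteDimensional K (Submodule.span K (L : Set V)) := by
  obtain ⟨s, hs⟩ := hL
  rw [← hs, Submodule.span_span_of_tower]
  exact FiniteDimensional.span_of_finite K s.finite_toSet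

/-- The inductive statement behind `exists_rankOne_decomposition` (induction on `n = dim_K KL`).
[cite: JKPRST2018IsogenousPowerElliptic, §3.2 Thm. 3.2 (1), p. 6] -/
private theorem exists_rankOne_decomposition_aux (h2 : finrank ℚ K = 2) (n : ℕ) :
    ∀ (L : Submodule ℤ V) (θ₀ : K), (∀ q : ℚ, (q : K) ≠ θ₀) → L.FG → (∀ v ∈ L, θ₀ • v ∈ L) →
      finrank K (Submodule.span K (L : Set V)) = n →
      ∃ (y : Fin n → V) (α β : Fin n → K),
        LinearIndependent K y ∧ (∀ i, y i ∈ L) ∧ (∀ i, LinearIndependent ℚ ![α i, β i]) ∧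
        (∀ v : V, v ∈ L ↔ ∃ c : Fin n → K,
          (∀ i, c i ∈ Submodule.span ℤ ({α i, β i} : Set K)) ∧ v = ∑ i, c i • y i) ∧
        Submodule.span K (Set.range y) = Submodule.span K (L : Set V) := by
  classical
  induction n with
  | zero =>
    intro L θ₀ hθ₀ hL hθ₀L hrank
    haveI := finiteDimensional_span_of_fg (K := K) hL
    have hspan : Submodule.span K (L : Set V) = ⊥ := Submodule.finrank_eq_zero.1 hrank
    have hL0 : ∀ v, v ∈ L ↔ v = 0 := by
      intro v
      constructor
      · intro hv
        have : v ∈ Submodule.span K (L : Set V) := Submodule.subset_span hv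
        rw [hspan] at this
        exact (Submodule.mem_bot K).1 this
      · rintro rfl; exact L.zero_mem
    refine ⟨Fin.elim0, Fin.elim0, Fin.elim0, linearIndependent_empty_type, fun i => i.elim0,
      fun i => i.elim0, fun v => ?_, ?_⟩
    · rw [hL0]
      constructor
      · rintro rfl; exact ⟨Fin.elim0, fun i => i.elim0, by simp⟩
      · rintro ⟨c, -, rfl⟩; simp
    · rw [hspan, Set.range_eq_empty, Submodule.span_empty]
  | succ n ih =>
    intro L θ₀ hθ₀ hL hθ₀L hrank
    haveI := finiteDimensional_span_of_fg (K := K) hL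
    have hL0 : L ≠ ⊥ := by
      rintro rfl
      rw [Submodule.bot_coe, Submodule.span_singleton_eq_bot.2 rfl] at hrank
      · simp at hrank
    -- the multiplier order `O = ℤ + ℤθ`, a good vector `m`, and the splitting `L = I_m m ⊕ L₂`
    obtain ⟨O, hO⟩ := exists_multiplier (K := K) L
    obtain ⟨θ, hθ, hOeq, -⟩ := multiplier_eq_span_one_pair h2 hL hL0 hθ₀ hθ₀L hO
    obtain ⟨m, hmL, hm0, hgood⟩ := exists_good_vector h2 hL hL0 hO hθ hOeq
    obtain ⟨α₀, β₀, L₂, hli₀, hJ, hL₂L, hθL₂, hmL₂, hdec⟩ :=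
      exists_splitting h2 hL hO hθ hOeq hmL hm0 hgood
    have hL₂fg : L₂.FG := fg_of_le hL₂L hL
    haveI := finiteDimensional_span_of_fg (K := K) hL₂fg
    -- `KL = Km ⊕ KL₂`, so `dim KL₂ = n`
    have hsup : Submodule.span K (L : Set V) = (K ∙ m) ⊔ Submodule.span K (L₂ : Set V) := by
      apply le_antisymm
      · rw [Submodule.span_le]
        intro v hv
        obtain ⟨x, -, w, hw, rfl⟩ := (hdec v).1 hv
        exact Submodule.add_mem_sup (Submodule.smul_mem _ x (Submodule.mem_span_singleton_self m))
          (Submodule.subset_span hw)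
      · exact sup_le (by rw [Submodule.span_singleton_le_iff_mem]; exact Submodule.subset_span hmL)
          (Submodule.span_mono hL₂L)
    have hinf : (K ∙ m) ⊓ Submodule.span K (L₂ : Set V) = ⊥ :=
      disjoint_iff.1 ((Submodule.disjoint_span_singleton' hm0).2 hmL₂).symm
    have hrank₂ : finrank K (Submodule.span K (L₂ : Set V)) = n := by
      have h := Submodule.finrank_sup_add_finrank_inf_eq (K ∙ m) (Submodule.span K (L₂ : Set V))
      rw [← hsup, hinf, finrank_bot, add_zero, hrank, finrank_span_singleton hm0] at h
      omega
    -- induction hypothesis for `L₂` (stable under the irrational `θ`)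
    obtain ⟨y, α, β, hliy, hyL₂, hαβ, hmem, hspan⟩ := ih L₂ θ hθ hL₂fg hθL₂ hrank₂
    refine ⟨Fin.cons m y, Fin.cons α₀ α, Fin.cons β₀ β, ?_, ?_, ?_, fun v => ?_, ?_⟩
    · rw [linearIndependent_finCons]
      refine ⟨hliy, ?_⟩
      rw [hspan]; exact hmL₂
    · intro i
      refine Fin.cases hmL (fun j => ?_) i
      rw [Fin.cons_succ]; exact hL₂L (hyL₂ j)
    · intro i
      refine Fin.cases ?_ (fun j => ?_) i
      · simpa using hli₀
      · simpa using hαβ j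
    · rw [hdec]
      constructor
      · rintro ⟨x, hx, w, hw, rfl⟩
        obtain ⟨c, hc, rfl⟩ := (hmem w).1 hw
        refine ⟨Fin.cons x c, fun i => Fin.cases (by simpa using hx) (fun j => by simpa using hc j) i, ?_⟩
        rw [Fin.sum_univ_succ]
        simp
      · rintro ⟨c, hc, rfl⟩
        refine ⟨c 0, by simpa using hc 0, ∑ j : Fin n, c j.succ • y j,
          (hmem _).2 ⟨fun j => c j.succ, fun j => by simpa using hc j.succ, rfl⟩, ?_⟩
        rw [Fin.sum_univ_succ]
        simp
    · rw [Fin.range_cons, Submodule.span_insert, hspan, hsup]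

/-- **BOREVICH–FADDEEV FOR QUADRATIC ORDERS (Jordan–Keeton–Poonen–Rains–Shepherd-Barron–Tate 2018,
Thm. 3.2 (1)), EXISTENCE OF A RANK-ONE DECOMPOSITION.**  Let `K` be a quadratic field, `V` a
`K`-vector space and `L ⊆ V` a finitely generated `ℤ`-submodule stable under some irrational `θ₀ ∈ K`
(i.e. a lattice over the order `ℤ[θ₀]`; its full multiplier ring `{x : xL ⊆ L}` is then a quadratic
order `R(L) ⊇ ℤ[θ₀]`).  Then `L = I₁y₁ ⊕ ⋯ ⊕ Iₙyₙ`: there are `K`-linearly independent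
`y₁, …, yₙ ∈ L` spanning `KL` (`n = dim_K KL`) and rank-two lattices `Iᵢ = ℤαᵢ + ℤβᵢ ⊂ K`
(`αᵢ, βᵢ` `ℚ`-independent; each `Iᵢ ∋ 1` is an invertible ideal of its own order, Cox Prop. 7.4)
such that `v ∈ L ⟺ v = Σ cᵢyᵢ` with `cᵢ ∈ Iᵢ`.  JKPRST: «Let `R` be a quadratic order … Let `M` be a
f.p. torsion-free `R`-module. There exists a unique chain of orders `R₁ ⊆ ⋯ ⊆ Rₙ` between `R` and `K`
and invertible ideals `I₁, …, Iₙ` of `R₁, …, Rₙ`, respectively, such that `M ≅ I₁ ⊕ ⋯ ⊕ Iₙ` as an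
`R`-module. … Proof. See [Borevich–Faddeev 1960].»  Formalised here: the existence of the
decomposition (our `I₁` even has `R(I₁) = R(L)` by construction); the chain condition and the
uniqueness are not.
-- TODO(general form): the chain `R(I₁) ⊆ ⋯ ⊆ R(Iₙ)` and uniqueness (Thm. 3.2 (1)–(3)).
[cite: JKPRST2018IsogenousPowerElliptic, §3.2 Thm. 3.2 (1), p. 6] -/
theorem exists_rankOne_decomposition (h2 : finrank ℚ K = 2) {L : Submodule ℤ V} (hL : L.FG)
    {θ₀ : K} (hθ₀ : ∀ q : ℚ, (q : K) ≠ θ₀) (hθ₀L : ∀ v ∈ L, θ₀ • v ∈ L) :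
    ∃ (n : ℕ) (y : Fin n → V) (α β : Fin n → K),
      n = finrank K (Submodule.span K (L : Set V)) ∧
      LinearIndependent K y ∧ (∀ i, y i ∈ L) ∧ (∀ i, LinearIndependent ℚ ![α i, β i]) ∧
      (∀ v : V, v ∈ L ↔ ∃ c : Fin n → K,
        (∀ i, c i ∈ Submodule.span ℤ ({α i, β i} : Set K)) ∧ v = ∑ i, c i • y i) ∧
      Submodule.span K (Set.range y) = Submodule.span K (L : Set V) := by
  obtain ⟨y, α, β, h⟩ := exists_rankOne_decomposition_aux h2 _ L θ₀ hθ₀ hL hθ₀L rfl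
  exact ⟨_, y, α, β, rfl, h⟩

omit [CharZero K] in
/-- **The coefficients are unique and the `i`-th coefficient lattice is `Iᵢ`**: with a decomposition
as above, `c • yᵢ ∈ L ⟺ c ∈ ℤαᵢ + ℤβᵢ` — O'Meara's 81:4 «the coefficient of `yᵢ` in `L` is `𝔞ᵢ`»,
verbatim for orders. [cite: Omeara1963, §81B 81:4, p. 212] -/
theorem smul_mem_iff_of_decomposition {n : ℕ} {L : Submodule ℤ V} {y : Fin n → V} {α β : Fin n → K}
    (hli : LinearIndependent K y)
    (hmem : ∀ v : V, v ∈ L ↔ ∃ c : Fin n → K,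
      (∀ i, c i ∈ Submodule.span ℤ ({α i, β i} : Set K)) ∧ v = ∑ i, c i • y i)
    (i : Fin n) (c : K) : c • y i ∈ L ↔ c ∈ Submodule.span ℤ ({α i, β i} : Set K) := by
  classical
  constructor
  · intro h
    obtain ⟨c', hc', he⟩ := (hmem _).1 h
    -- compare coefficients: `c' = δᵢ c`
    have hz : ∀ j, c' j - (Pi.single i c : Fin n → K) j = 0 := by
      refine Fintype.linearIndependent_iff.1 hli (fun j => c' j - (Pi.single i c : Fin n → K) j) ?_
      simp_rw [sub_smul, Finset.sum_sub_distrib, ← he]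
      rw [Finset.sum_eq_single i, Pi.single_eq_same, sub_self]
      · intro j _ hj; rw [Pi.single_eq_of_ne hj, zero_smul]
      · intro hi; exact (hi (Finset.mem_univ i)).elim
    have hci : c' i = c := by
      have := hz i
      rwa [Pi.single_eq_same, sub_eq_zero] at this
    rw [← hci]; exact hc' i
  · intro hc
    refine (hmem _).2 ⟨Pi.single i c, fun j => ?_, ?_⟩
    · by_cases hj : j = i
      · subst hj; rwa [Pi.single_eq_same]
      · rw [Pi.single_eq_of_ne hj]; exact Submodule.zero_mem _
    · rw [Finset.sum_eq_single i (fun j _ hj => by rw [Pi.single_eq_of_ne hj, zero_smul])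
        (fun h => (h (Finset.mem_univ i)).elim), Pi.single_eq_same]

end Decomposition

end QuadraticOrderLattice

end Literature.NumberTheory.QuadraticFields
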